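import Literature.NumberTheory.EllipticCurves.KubotaLeopoldtTwoNumerator
import Literature.NumberTheory.EllipticCurves.PAdicMeasureTransformTranslationProofs
import Literature.NumberTheory.ModularForms.DedekindSumRademacherPhi
import HarnessLib

/-!
# Convolution of bounded distributions on `ℤ_p^×` and the product of their Iwasawa–Mellin
# transforms; at `p = 2`: the smoothed Dedekind–Eisenstein measure `(χ₋₄E_{1,5})ˇ ⋆ (χ₋₄E_{1,5})`
# has transform `G(T^ι)·G(T)` (PROOFS ONLY — no named fact)

Lang (*Cyclotomic Fields I and II*, Ch. 4 §1, PDF pp. 77–79, and Ch. 12 §1, PDF p. 187) identifies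
`𝔬`-valued measures on a profinite abelian group `Z` with the Iwasawa algebra `Λ_𝔬(Z)`, "the product
in `Λ_𝔬(Z)` corresponds to the convolution of measures", and for `Z = ℤ_p^×`, pulled back to
`Γ = 1 + p^{e₀}ℤ_p = γ^{ℤ_p}`, the power series `f` of Ch. 4 §1 Example 2 (`∫ u^s dν = f(γ^s − 1)`) —
the tree's `distributionTransform` (`KubotaLeopoldtTwoNumerator.lean` §1; Mazur–Tate–Teitelbaum,
Invent. Math. 84 (1986) §I.13, coefficientwise limits of Riemann sums over the classes `ηγ^s`) —
is therefore MULTIPLICATIVE under the multiplicative convolution of measures on `ℤ_p^×`.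
This file proves that statement in the tree's Riemann-sum formalism, for every prime `p`:

* `unitsConv μ ν n a = ∑_{x ∈ (ℤ/pⁿ)^×} μ(x + pⁿℤ_p)·ν(a x⁻¹ + pⁿℤ_p)` — the convolution on the unit
  classes (§1: bound `‖μ ⋆ ν‖ ≤ ‖μ‖‖ν‖`, support, evenness, commutativity; §2: it satisfies the
  distribution relation when `μ`, `ν` do and `μ` lives on `ℤ_p^×` — "the convolution of two measures
  on `ℤ_p^×` is a measure on `ℤ_p^×`");
* **`distributionTransform_unitsConv`** (§3): for bounded distributions `μ`, `ν`,
  `L_{μ ⋆ ν}(T) = L_μ(T) · L_ν(T)` in `ℚ_p⟦T⟧`.  Proof: writing the units modulo `p^{n+e₀}` as classes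
  `ηγ^s` (`η` Teichmüller, `s mod pⁿ`; `finsum_sum_classes_eq_sum_units`, `classMap_mul`), the `n`-th
  Riemann sum of `[T^k]L_{μ⋆ν}` is `∑_{(η₁,s₁),(η₂,s₂)} μ(η₁γ^{s₁})ν(η₂γ^{s₂})·((s₁+s₂ mod pⁿ) choose k)`,
  while `∑_{i+j=k} RS_μ(i,n)RS_ν(j,n)` is the same double sum with `((s₁+s₂) choose k)` (Vandermonde);
  the two binomials are `p`-adically `p^{-n}/‖k!‖`-close (`norm_choose_sub_choose_le`), so the
  difference tends to `0` and the limits agree (`PowerSeries.coeff_mul`) — the coefficientwise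
  technique of `PAdicMeasureTransformTranslationProofs` (translation = convolution with a Dirac mass);
* **at `p = 2`** (§4): the convolution `(χ₋₄E_{1,5})ˇ ⋆ (χ₋₄E_{1,5})` of the tree's `klTwoMeasureInv`
  and `klTwoMeasure` (`KubotaLeopoldtTwoNumerator.lean` §4) is an even measure on `ℤ₂^×` bounded by `1`
  whose transform is **`klTwoNumeratorInv * klTwoNumerator = G(T^ι)·G(T)`**
  (`distributionTransform_klTwoConv`).  This is the `p = 2`, `r₁ = r₂ = 5` instance of Stevens'
  SMOOTHED Eisenstein/Bernoulli measure: Stevens (*Arithmetic on Modular Curves*, §5.2, PDF pp. 68–69,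
  `Sm_r λ_B = (1 − rσ(r))λ_B`; §5.4, PDF p. 73, `Sm_{r₁}^{r₂}(μ_E) = (1 − r₁σ(r₁))(1 − r₂σ(r₂)⁻¹)μ_E`,
  Prop. 5.4.1 "is a measure") smooths the unbounded Dedekind-symbol distribution of a weight-2
  Eisenstein series — whose values `s_E` are Dedekind sums `∑_i B₁(i/m)B₁(hi/m)` (Stevens §2.5), i.e.
  convolutions `B₁ˇ ⋆ B₁` on `(ℤ/m)^×` — into a measure, and obtains (end of §5.4, PDF p. 74) the
  factorisation `L_p(E, χ, s) = ε₁(Δ)χ̄(N₁)⟨N₁⟩^{1−s}·L_p(ε̄₁χω, 1−s)·L_p(ε₂χ̄ω, s−1)` into two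
  Kubota–Leopoldt factors for `p ∤ 2N`, `χ` non-exceptional.  Since `E_{1,5} = (1 − 5·[5]_*)E₁`
  (Lang Ch. 2 §2), the convolution of the REGULARISED measures here is exactly `Sm_5^5` of the
  convolution of the unregularised `χ₋₄B₁`'s; its transform is the product of the two `2`-adic
  Kubota–Leopoldt numerators — the `Ḡ·Ḡ^ι` of the mod-2 Eisenstein identity studied Summit-side
  (cell bsd-rank2, crux `stmt-BirchSwinnertonDyer-20341`, line `star`, stub (★-Eis); nothing about it,
  about elliptic curves or about BSD is asserted here).

Everything is proved; no instance, no notation, no named fact.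

§5–§6 (appended): the ALGEBRA of `⋆` — bilinearity; the push-forward `dilate c μ = [c]_*μ`
(`a ↦ μ(ac⁻¹)`, Stevens' `σ(c)·μ`) and pull-back `codilate c μ = [c]^*μ` (`a ↦ μ(ac)`) along
multiplication by `c` prime to `p`: they preserve bounds, support and the distribution relation,
commute with `⋆` on either side, are exchanged by the inversion `μ ↦ μ̌` (`invUnitsDist_dilate`), and
multiply the transform by `(1+T)^{ℓ(c)}` resp. `(1+T)^{−ℓ(c)}` (`distributionTransform_dilate`,
`distributionTransform_codilate`, from `PAdicMeasureTransformTranslationProofs`; Lang Ch. 4 §2 Meas 1);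
the unregularised `θ`-twisted Bernoulli distribution `bernoulliDistribution p N θ k` (Lang's `E_k`,
Stevens' `λ_B`: a distribution, `bernoulliDistribution_distribution`, not a measure) with **Lang's
regularisation as Stevens' smoothing**: `bernoulliMeasure p N c θ k = (1 − c^kθ(c)·[c]_*)(bernoulliDistribution p N θ k)`
(`bernoulliMeasure_eq_sub_dilate`); and at `p = 2`: `klTwoMeasure = (1 − 5[5]_*)(χ₋₄E₁)`,
`klTwoMeasureInv = (1 − 5[5]^*)((χ₋₄E₁)ˇ)`, hence **`klTwoConv = Sm_5^5(D) = D − 5[5]_*D − 5[5]^*D + 25D`**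
for the `χ₋₄`-weighted Dedekind convolution `D = klTwoDedekindConv = (χ₋₄E₁)ˇ ⋆ (χ₋₄E₁)`
(`klTwoConv_eq_smoothing` — Stevens' Prop. 5.4.1 smoothing, verbatim), whose level-`n ≥ 2` values are
`χ₋₄(h)·∑_{x odd} E_1^{(2ⁿ)}(x⁻¹)E_1^{(2ⁿ)}(hx⁻¹) = χ₋₄(h)·(s(h,2ⁿ) − s(h,2ⁿ⁻¹))` in Dedekind-sum shape
(`klTwoDedekindConv_eq_of_two_le`, stated with the tree's `bernoulliDist`; no Dedekind-sum notion is
defined here).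

§7 (appended): the BRIDGE to the tree's Dedekind sums (`Literature.NumberTheory.ModularForms.dedekindSum`,
Rademacher–Grosswald Ch. 1 (1)–(2)): for every prime `p`, `s(h, p^{n+1}) = ∑_{x ∈ (ℤ/p^{n+1})^×}
((x/p^{n+1}))((hx/p^{n+1})) + s(h, pⁿ)` (`dedekindSum_pow_succ_eq_sum_units_add` — the non-unit terms
`μ = pν` are the terms of `s(h, pⁿ)`), `E_1^{(M)}(b) = ((b/M))` for `b ≢ 0`
(`bernoulliDist_one_eq_dedekindSaw`), and hence at `p = 2`, for `n ≥ 2` and odd `h`: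
**`klTwoDedekindConv n h = χ₋₄(h)·(s(h, 2ⁿ) − s(h, 2ⁿ⁻¹))`** (`klTwoDedekindConv_eq_dedekindSum`).

## References

* S. Lang, *Cyclotomic Fields I and II*, GTM 121, Springer 1990 — Ch. 2 §2 (`E_{k,c}`), Ch. 4 §1
  (Iwasawa isomorphism, Example 2; PDF pp. 77–79), §2 (operations on measures, PDF pp. 80–82),
  Ch. 12 §1 (PDF p. 187: "the product in `Λ_𝔬(Z)` corresponds to the convolution of measures").
  Held text `book:lang1990-cyclotomic-fields-i-ii`. [LangCyclotomic1990]
* B. Mazur, J. Tate, J. Teitelbaum, *On `p`-adic analogues of the conjectures of Birch and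
  Swinnerton-Dyer*, Invent. Math. 84 (1986) 1–48, §I.11–I.13. [MazurTateTeitelbaum1986Invent]
* G. Stevens, *Arithmetic on Modular Curves*, Progress in Math. 20, Birkhäuser 1982 — §2.5 (Dedekind
  symbol), §5.2 (PDF pp. 68–69), §5.4 (PDF pp. 72–74, Prop. 5.4.1). Held text
  `book:stevensnd-arithmetic-modular-curves`. [Stevens1982]
* H. Rademacher, E. Grosswald, *Dedekind Sums*, Carus Math. Monographs 16, MAA 1972, Ch. 1 eq. (1)–(2).
  [RademacherGrosswald1972]
-/

noncomputable section

open scoped Classical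

open Filter Topology

namespace Literature.NumberTheory.EllipticCurves

variable {p : ℕ} [Fact p.Prime]

/-! ## §1 The convolution on the unit classes -/

section Defs

/-- **The (multiplicative) convolution of two set functions on the unit classes of `ℤ/pⁿ`**:
`(μ ⋆ ν)(a + pⁿℤ_p) = ∑_{x ∈ (ℤ/pⁿ)^×} μ(x + pⁿℤ_p) · ν(a x⁻¹ + pⁿℤ_p)` — the level-`n` component of
the convolution of the measures `μ|_{ℤ_p^×}`, `ν|_{ℤ_p^×}` on the group `ℤ_p^× = lim (ℤ/pⁿ)^×`, i.e. of
the product in the Iwasawa algebra `Λ(ℤ_p^×) = lim 𝔬[(ℤ/pⁿ)^×]` (Lang Ch. 12 §1).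
[cite: LangCyclotomic1990, Ch. 12 §1 (PDF p. 187: product in Λ_o(Z) = convolution of measures) and Ch. 4 §1 (PDF pp. 77–78)] -/
def unitsConv (μ ν : (n : ℕ) → ZMod (p ^ n) → ℚ_[p]) (n : ℕ) (a : ZMod (p ^ n)) : ℚ_[p] :=
  ∑ x : (ZMod (p ^ n))ˣ, μ n (x : ZMod (p ^ n)) * ν n (a * ((x⁻¹ : (ZMod (p ^ n))ˣ) : ZMod (p ^ n)))

variable (μ ν : (n : ℕ) → ZMod (p ^ n) → ℚ_[p])

/-- Unfolding of `unitsConv`. [cite: LangCyclotomic1990, Ch. 12 §1 (PDF p. 187) (unfolding)] -/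
theorem unitsConv_apply (n : ℕ) (a : ZMod (p ^ n)) :
    unitsConv μ ν n a =
      ∑ x : (ZMod (p ^ n))ˣ, μ n (x : ZMod (p ^ n)) * ν n (a * ((x⁻¹ : (ZMod (p ^ n))ˣ) : ZMod (p ^ n))) :=
  rfl

variable {μ ν}

/-- **`‖μ ⋆ ν‖ ≤ ‖μ‖·‖ν‖`**: the convolution of set functions bounded by `C` and `D` is bounded by
`C·D` (`ℚ_p` is non-archimedean). [cite: LangCyclotomic1990, Ch. 4 §1 (norm of a measure, PDF pp. 77–78) and Ch. 12 §1 (PDF p. 187)] -/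
theorem norm_unitsConv_le {C D : ℝ} (hC : ∀ (n : ℕ) (a : ZMod (p ^ n)), ‖μ n a‖ ≤ C)
    (hD : ∀ (n : ℕ) (a : ZMod (p ^ n)), ‖ν n a‖ ≤ D) (n : ℕ) (a : ZMod (p ^ n)) :
    ‖unitsConv μ ν n a‖ ≤ C * D := by
  have hC0 : 0 ≤ C := (norm_nonneg _).trans (hC 0 0)
  have hD0 : 0 ≤ D := (norm_nonneg _).trans (hD 0 0)
  unfold unitsConv
  refine IsUltrametricDist.norm_sum_le_of_forall_le_of_nonneg (mul_nonneg hC0 hD0) fun x _ ↦ ?_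
  rw [norm_mul]
  exact mul_le_mul (hC _ _) (hD _ _) (norm_nonneg _) hC0

/-- The convolution vanishes on the non-unit classes of positive level as soon as `ν` does (for a
unit `x`, `a x⁻¹` is a unit only if `a` is). [cite: LangCyclotomic1990, Ch. 12 §1 (PDF p. 187) (measures on the unit group)] -/
theorem unitsConv_eq_zero_of_not_isUnit
    (hν0 : ∀ n : ℕ, 1 ≤ n → ∀ a : ZMod (p ^ n), ¬ IsUnit a → ν n a = 0) {n : ℕ} (hn : 1 ≤ n)
    {a : ZMod (p ^ n)} (ha : ¬ IsUnit a) : unitsConv μ ν n a = 0 := by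
  unfold unitsConv
  refine Finset.sum_eq_zero fun x _ ↦ ?_
  have hax : ¬ IsUnit (a * ((x⁻¹ : (ZMod (p ^ n))ˣ) : ZMod (p ^ n))) := by
    intro h
    apply ha
    have h' : a = a * ((x⁻¹ : (ZMod (p ^ n))ˣ) : ZMod (p ^ n)) * (x : ZMod (p ^ n)) := by
      rw [mul_assoc, Units.inv_mul, mul_one]
    rw [h']
    exact h.mul (Units.isUnit x)
  rw [hν0 n hn _ hax, mul_zero]

/-- The convolution with an EVEN `ν` is even: `(μ ⋆ ν)(−a) = (μ ⋆ ν)(a)`.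
[cite: LangCyclotomic1990, Ch. 12 §1 (PDF p. 187) (convolution of measures)] -/
theorem unitsConv_neg (hν : ∀ (n : ℕ) (a : ZMod (p ^ n)), ν n (-a) = ν n a) (n : ℕ)
    (a : ZMod (p ^ n)) : unitsConv μ ν n (-a) = unitsConv μ ν n a := by
  unfold unitsConv
  refine Finset.sum_congr rfl fun x _ ↦ ?_
  rw [neg_mul, hν]

/-- **Commutativity on the unit classes**: `(μ ⋆ ν)(a) = (ν ⋆ μ)(a)` for `a` a unit (substitute
`x ↦ a x⁻¹`). [cite: LangCyclotomic1990, Ch. 12 §1 (PDF p. 187) (Λ_o(Z) is commutative for abelian Z)] -/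
theorem unitsConv_comm_of_isUnit {n : ℕ} {a : ZMod (p ^ n)} (ha : IsUnit a) :
    unitsConv μ ν n a = unitsConv ν μ n a := by
  unfold unitsConv
  obtain ⟨u, rfl⟩ := ha
  -- the involution `x ↦ u x⁻¹` of the unit group
  have hσinv : Function.Involutive (fun x : (ZMod (p ^ n))ˣ ↦ u * x⁻¹) := fun x ↦ by
    simp only [mul_inv_rev, inv_inv, mul_left_comm u x u⁻¹, mul_inv_cancel, mul_one]
  refine (Fintype.sum_bijective _ hσinv.bijective _ _ fun x ↦ ?_).symm
  simp only [mul_inv_rev, inv_inv, Units.val_mul]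
  rw [mul_left_comm (u : ZMod (p ^ n)) (x : ZMod (p ^ n)), Units.mul_inv, mul_one, mul_comm]

/-- **Commutativity**: `μ ⋆ ν = ν ⋆ μ` when both set functions vanish on the non-unit classes of
positive level (at level `0` every class is a unit).
[cite: LangCyclotomic1990, Ch. 12 §1 (PDF p. 187) (Λ_o(Z) is commutative for abelian Z)] -/
theorem unitsConv_comm
    (hμ0 : ∀ n : ℕ, 1 ≤ n → ∀ a : ZMod (p ^ n), ¬ IsUnit a → μ n a = 0)
    (hν0 : ∀ n : ℕ, 1 ≤ n → ∀ a : ZMod (p ^ n), ¬ IsUnit a → ν n a = 0) :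
    unitsConv μ ν = unitsConv ν μ := by
  funext n a
  by_cases ha : IsUnit a
  · exact unitsConv_comm_of_isUnit ha
  · rcases Nat.eq_zero_or_pos n with hn | hn
    · subst hn
      haveI : Subsingleton (ZMod (p ^ 0)) := ZMod.subsingleton_iff.mpr (pow_zero p)
      exact absurd (isUnit_of_subsingleton a) ha
    · rw [unitsConv_eq_zero_of_not_isUnit hν0 hn ha, unitsConv_eq_zero_of_not_isUnit hμ0 hn ha]

end Defs

/-! ## §2 The convolution of two measures on `ℤ_p^×` is a measure on `ℤ_p^×` -/

section Distribution

variable {μ ν : (n : ℕ) → ZMod (p ^ n) → ℚ_[p]}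

/-- **Fibres of the unit groups**: for a distribution `μ` vanishing on the non-unit classes of
positive level, `∑_{y ∈ (ℤ/p^{n+1})^×, y ≡ x (pⁿ)} μ(y + p^{n+1}ℤ_p) = μ(x + pⁿℤ_p)` for every unit
`x mod pⁿ` (the fibre of `x` in `ℤ/p^{n+1}` consists of units, except over level `0` where the one
non-unit class carries no mass) — the distribution relation of `μ|_{ℤ_p^×}` on the projective system
`(ℤ/p^{n+1})^× → (ℤ/pⁿ)^×` (Lang Ch. 12 §1: a measure on `Z = lim Z/H` is a compatible family).
[cite: LangCyclotomic1990, Ch. 12 §1 (PDF p. 187, measures on the projective system {Z/H})] [cite: MazurTateTeitelbaum1986Invent, §I.11 (distribution relation)] -/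
theorem sum_units_fiber_of_distribution
    (hdist : ∀ (n : ℕ) (a : ZMod (p ^ n)),
      ∑ b ∈ Finset.univ.filter (fun b : ZMod (p ^ (n + 1)) ↦
        ZMod.castHom (pow_dvd_pow p n.le_succ) (ZMod (p ^ n)) b = a), μ (n + 1) b = μ n a)
    (hμ0 : ∀ n : ℕ, 1 ≤ n → ∀ a : ZMod (p ^ n), ¬ IsUnit a → μ n a = 0) (n : ℕ)
    (x : (ZMod (p ^ n))ˣ) :
    ∑ y ∈ Finset.univ.filter (fun y : (ZMod (p ^ (n + 1)))ˣ ↦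
        Units.map (ZMod.castHom (pow_dvd_pow p n.le_succ) (ZMod (p ^ n))).toMonoidHom y = x),
      μ (n + 1) (y : ZMod (p ^ (n + 1))) = μ n (x : ZMod (p ^ n)) := by
  haveI : NeZero (p ^ (n + 1)) := ⟨pow_ne_zero _ (Fact.out : p.Prime).ne_zero⟩
  rw [← hdist n (x : ZMod (p ^ n))]
  -- the fibre sum over all classes splits into units and non-units; the latter carry no mass
  have hsplit : ∑ b ∈ Finset.univ.filter (fun b : ZMod (p ^ (n + 1)) ↦
      ZMod.castHom (pow_dvd_pow p n.le_succ) (ZMod (p ^ n)) b = x), μ (n + 1) b =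
      ∑ b ∈ (Finset.univ.filter (fun b : ZMod (p ^ (n + 1)) ↦ IsUnit b)).filter
        (fun b ↦ ZMod.castHom (pow_dvd_pow p n.le_succ) (ZMod (p ^ n)) b = x), μ (n + 1) b := by
    rw [Finset.filter_filter]
    refine (Finset.sum_subset (fun b hb ↦ ?_) (fun b hb hb' ↦ ?_)).symm
    · simp only [Finset.mem_filter, Finset.mem_univ, true_and] at hb ⊢
      exact hb.2
    · simp only [Finset.mem_filter, Finset.mem_univ, true_and, not_and] at hb hb'
      have hbu : ¬ IsUnit b := fun h ↦ hb' h hb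
      exact hμ0 (n + 1) (Nat.succ_pos n) b hbu
  have hiff : ∀ y : (ZMod (p ^ (n + 1)))ˣ,
      Units.map (ZMod.castHom (pow_dvd_pow p n.le_succ) (ZMod (p ^ n))).toMonoidHom y = x ↔
      ZMod.castHom (pow_dvd_pow p n.le_succ) (ZMod (p ^ n)) (y : ZMod (p ^ (n + 1))) = x := by
    intro y
    rw [← Units.val_inj, Units.coe_map, RingHom.toMonoidHom_eq_coe, MonoidHom.coe_coe]
  rw [hsplit, Finset.sum_filter, Finset.sum_filter]
  simp only [hiff]
  exact sum_units_eq_sum_filter_isUnit (F := fun b : ZMod (p ^ (n + 1)) ↦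
    if ZMod.castHom (pow_dvd_pow p n.le_succ) (ZMod (p ^ n)) b = x then μ (n + 1) b else 0)

/-- **The convolution of two distributions on `ℤ_p^×` is a distribution**: if `μ` and `ν` satisfy
the distribution relation and `μ` vanishes on the non-unit classes of positive level, then
`∑_{b ≡ a (pⁿ)} (μ ⋆ ν)(b + p^{n+1}ℤ_p) = (μ ⋆ ν)(a + pⁿℤ_p)`.  Proof: `∑_{b ≡ a} ν(b y⁻¹) = ν(a ȳ⁻¹)`
for each unit `y mod p^{n+1}` (translate the fibre of `a` by `y⁻¹`), then group the units `y` by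
their reduction `ȳ mod pⁿ` (`sum_units_fiber_of_distribution`).
[cite: LangCyclotomic1990, Ch. 12 §1 (PDF p. 187: measures = compatible families, product = convolution)] -/
theorem unitsConv_distribution
    (hμ : ∀ (n : ℕ) (a : ZMod (p ^ n)),
      ∑ b ∈ Finset.univ.filter (fun b : ZMod (p ^ (n + 1)) ↦
        ZMod.castHom (pow_dvd_pow p n.le_succ) (ZMod (p ^ n)) b = a), μ (n + 1) b = μ n a)
    (hμ0 : ∀ n : ℕ, 1 ≤ n → ∀ a : ZMod (p ^ n), ¬ IsUnit a → μ n a = 0)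
    (hν : ∀ (n : ℕ) (a : ZMod (p ^ n)),
      ∑ b ∈ Finset.univ.filter (fun b : ZMod (p ^ (n + 1)) ↦
        ZMod.castHom (pow_dvd_pow p n.le_succ) (ZMod (p ^ n)) b = a), ν (n + 1) b = ν n a)
    (n : ℕ) (a : ZMod (p ^ n)) :
    ∑ b ∈ Finset.univ.filter (fun b : ZMod (p ^ (n + 1)) ↦
        ZMod.castHom (pow_dvd_pow p n.le_succ) (ZMod (p ^ n)) b = a), unitsConv μ ν (n + 1) b =
      unitsConv μ ν n a := by
  haveI : NeZero (p ^ (n + 1)) := ⟨pow_ne_zero _ (Fact.out : p.Prime).ne_zero⟩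
  haveI : NeZero (p ^ n) := ⟨pow_ne_zero _ (Fact.out : p.Prime).ne_zero⟩
  -- `ȳ⁻¹` reduces `y⁻¹`
  have hπu_inv : ∀ y : (ZMod (p ^ (n + 1)))ˣ,
      (((Units.map (ZMod.castHom (pow_dvd_pow p n.le_succ) (ZMod (p ^ n))).toMonoidHom y)⁻¹ :
          (ZMod (p ^ n))ˣ) : ZMod (p ^ n)) =
        ZMod.castHom (pow_dvd_pow p n.le_succ) (ZMod (p ^ n))
          ((y⁻¹ : (ZMod (p ^ (n + 1)))ˣ) : ZMod (p ^ (n + 1))) := fun y ↦ by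
    rw [Units.coe_map_inv, RingHom.toMonoidHom_eq_coe, MonoidHom.coe_coe]
  -- Step 1: translate each fibre: `∑_{b ≡ a} ν(b y⁻¹) = ν(a ȳ⁻¹)`
  have hstep : ∀ y : (ZMod (p ^ (n + 1)))ˣ,
      ∑ b ∈ Finset.univ.filter (fun b : ZMod (p ^ (n + 1)) ↦
          ZMod.castHom (pow_dvd_pow p n.le_succ) (ZMod (p ^ n)) b = a),
        ν (n + 1) (b * ((y⁻¹ : (ZMod (p ^ (n + 1)))ˣ) : ZMod (p ^ (n + 1)))) =
        ν n (a * (((Units.map (ZMod.castHom (pow_dvd_pow p n.le_succ) (ZMod (p ^ n))).toMonoidHom y)⁻¹ :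
          (ZMod (p ^ n))ˣ) : ZMod (p ^ n))) := by
    intro y
    rw [← hν n (a * (((Units.map (ZMod.castHom (pow_dvd_pow p n.le_succ) (ZMod (p ^ n))).toMonoidHom y)⁻¹ :
      (ZMod (p ^ n))ˣ) : ZMod (p ^ n)))]
    -- reindex the fibre of `a` by `b ↦ b y⁻¹` onto the fibre of `a ȳ⁻¹`
    refine Finset.sum_nbij' (fun b ↦ b * ((y⁻¹ : (ZMod (p ^ (n + 1)))ˣ) : ZMod (p ^ (n + 1))))
      (fun c ↦ c * (y : ZMod (p ^ (n + 1)))) (fun b hb ↦ ?_) (fun c hc ↦ ?_) (fun b _ ↦ ?_)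
      (fun c _ ↦ ?_) (fun b _ ↦ rfl)
    · simp only [Finset.mem_filter, Finset.mem_univ, true_and] at hb ⊢
      rw [map_mul, hb, hπu_inv]
    · simp only [Finset.mem_filter, Finset.mem_univ, true_and] at hc ⊢
      rw [map_mul, hc, hπu_inv, mul_assoc, ← map_mul, Units.inv_mul, map_one, mul_one]
    · rw [mul_assoc, Units.inv_mul, mul_one]
    · rw [mul_assoc, Units.mul_inv, mul_one]
  calc ∑ b ∈ Finset.univ.filter (fun b : ZMod (p ^ (n + 1)) ↦
          ZMod.castHom (pow_dvd_pow p n.le_succ) (ZMod (p ^ n)) b = a), unitsConv μ ν (n + 1) b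
      = ∑ y : (ZMod (p ^ (n + 1)))ˣ, μ (n + 1) (y : ZMod (p ^ (n + 1))) *
          ∑ b ∈ Finset.univ.filter (fun b : ZMod (p ^ (n + 1)) ↦
              ZMod.castHom (pow_dvd_pow p n.le_succ) (ZMod (p ^ n)) b = a),
            ν (n + 1) (b * ((y⁻¹ : (ZMod (p ^ (n + 1)))ˣ) : ZMod (p ^ (n + 1)))) := by
        simp only [unitsConv, Finset.mul_sum]
        rw [Finset.sum_comm]
    _ = ∑ y : (ZMod (p ^ (n + 1)))ˣ, μ (n + 1) (y : ZMod (p ^ (n + 1))) *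
          ν n (a * (((Units.map (ZMod.castHom (pow_dvd_pow p n.le_succ) (ZMod (p ^ n))).toMonoidHom y)⁻¹ :
            (ZMod (p ^ n))ˣ) : ZMod (p ^ n))) := by
        refine Finset.sum_congr rfl fun y _ ↦ ?_
        rw [hstep y]
    _ = ∑ x : (ZMod (p ^ n))ˣ, ∑ y ∈ Finset.univ.filter (fun y : (ZMod (p ^ (n + 1)))ˣ ↦
            Units.map (ZMod.castHom (pow_dvd_pow p n.le_succ) (ZMod (p ^ n))).toMonoidHom y = x),
          μ (n + 1) (y : ZMod (p ^ (n + 1))) *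
            ν n (a * (((Units.map (ZMod.castHom (pow_dvd_pow p n.le_succ) (ZMod (p ^ n))).toMonoidHom y)⁻¹ :
              (ZMod (p ^ n))ˣ) : ZMod (p ^ n))) :=
        (Finset.sum_fiberwise Finset.univ
          (Units.map (ZMod.castHom (pow_dvd_pow p n.le_succ) (ZMod (p ^ n))).toMonoidHom) _).symm
    _ = ∑ x : (ZMod (p ^ n))ˣ, (∑ y ∈ Finset.univ.filter (fun y : (ZMod (p ^ (n + 1)))ˣ ↦
            Units.map (ZMod.castHom (pow_dvd_pow p n.le_succ) (ZMod (p ^ n))).toMonoidHom y = x),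
          μ (n + 1) (y : ZMod (p ^ (n + 1)))) * ν n (a * ((x⁻¹ : (ZMod (p ^ n))ˣ) : ZMod (p ^ n))) := by
        refine Finset.sum_congr rfl fun x _ ↦ ?_
        rw [Finset.sum_mul]
        refine Finset.sum_congr rfl fun y hy ↦ ?_
        rw [(Finset.mem_filter.mp hy).2]
    _ = unitsConv μ ν n a := by
        unfold unitsConv
        refine Finset.sum_congr rfl fun x _ ↦ ?_
        rw [sum_units_fiber_of_distribution hμ hμ0 n x]

/-- **The convolution of two measures on `ℤ_p^×` is a measure on `ℤ_p^×`** (packaged): distribution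
relation, bound `‖μ‖‖ν‖`, and no mass on the non-unit classes of positive level.
[cite: LangCyclotomic1990, Ch. 12 §1 (PDF p. 187)] -/
theorem unitsConv_isMeasure
    (hμ : ∀ (n : ℕ) (a : ZMod (p ^ n)),
      ∑ b ∈ Finset.univ.filter (fun b : ZMod (p ^ (n + 1)) ↦
        ZMod.castHom (pow_dvd_pow p n.le_succ) (ZMod (p ^ n)) b = a), μ (n + 1) b = μ n a)
    (hμ0 : ∀ n : ℕ, 1 ≤ n → ∀ a : ZMod (p ^ n), ¬ IsUnit a → μ n a = 0)
    {C : ℝ} (hC : ∀ (n : ℕ) (a : ZMod (p ^ n)), ‖μ n a‖ ≤ C)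
    (hν : ∀ (n : ℕ) (a : ZMod (p ^ n)),
      ∑ b ∈ Finset.univ.filter (fun b : ZMod (p ^ (n + 1)) ↦
        ZMod.castHom (pow_dvd_pow p n.le_succ) (ZMod (p ^ n)) b = a), ν (n + 1) b = ν n a)
    (hν0 : ∀ n : ℕ, 1 ≤ n → ∀ a : ZMod (p ^ n), ¬ IsUnit a → ν n a = 0)
    {D : ℝ} (hD : ∀ (n : ℕ) (a : ZMod (p ^ n)), ‖ν n a‖ ≤ D) :
    (∀ (n : ℕ) (a : ZMod (p ^ n)),
      ∑ b ∈ Finset.univ.filter (fun b : ZMod (p ^ (n + 1)) ↦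
        ZMod.castHom (pow_dvd_pow p n.le_succ) (ZMod (p ^ n)) b = a), unitsConv μ ν (n + 1) b =
        unitsConv μ ν n a) ∧
    (∀ (n : ℕ) (a : ZMod (p ^ n)), ‖unitsConv μ ν n a‖ ≤ C * D) ∧
    (∀ n : ℕ, 1 ≤ n → ∀ a : ZMod (p ^ n), ¬ IsUnit a → unitsConv μ ν n a = 0) :=
  ⟨unitsConv_distribution hμ hμ0 hν, norm_unitsConv_le hC hD,
    fun _ hn _ ha ↦ unitsConv_eq_zero_of_not_isUnit hν0 hn ha⟩

end Distribution

/-! ## §3 The transform of a convolution is the product of the transforms -/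

section Transform

/-- The unit `ηγ^s mod p^{n+e₀}` attached to a Teichmüller representative `η` and `s mod pⁿ`.
[folklore] -/
private def classUnit (n : ℕ) (x : rootsOfUnity (torsionOrder p) ℤ_[p] × ZMod (p ^ n)) :
    (ZMod (p ^ (n + cyclotomicExponent p)))ˣ :=
  (isUnit_classMap p n x).unit

/-- Unfolding of `classUnit`. [folklore] -/
private theorem classUnit_val (n : ℕ) (x : rootsOfUnity (torsionOrder p) ℤ_[p] × ZMod (p ^ n)) :
    ((classUnit n x : (ZMod (p ^ (n + cyclotomicExponent p)))ˣ) : ZMod (p ^ (n + cyclotomicExponent p))) =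
      PadicInt.toZModPow (n + cyclotomicExponent p) ((x.1 : ℤ_[p]ˣ) : ℤ_[p]) *
        (cyclotomicGenerator p : ZMod (p ^ (n + cyclotomicExponent p))) ^ x.2.val :=
  IsUnit.unit_spec _

/-- `(η, s) ↦ ηγ^s` is a bijection `μ_τ × ℤ/pⁿ → (ℤ/p^{n+e₀})^×`. [folklore] -/
private theorem classUnit_bijective (n : ℕ) [Fintype (rootsOfUnity (torsionOrder p) ℤ_[p])] :
    Function.Bijective (classUnit (p := p) n) := by
  have hinj : Function.Injective (classUnit (p := p) n) := fun x y hxy ↦ classMap_injective p n (by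
    have h := congr_arg Units.val hxy
    rwa [classUnit_val, classUnit_val] at h)
  exact (Fintype.bijective_iff_injective_and_card _).mpr ⟨hinj, card_classDomain p n⟩

/-- The inverse of the unit `ηγ^s` is the class `η⁻¹γ^{−s}`. [folklore] -/
private theorem classUnit_inv_val (n : ℕ) (x : rootsOfUnity (torsionOrder p) ℤ_[p] × ZMod (p ^ n)) :
    (((classUnit n x)⁻¹ : (ZMod (p ^ (n + cyclotomicExponent p)))ˣ) :
        ZMod (p ^ (n + cyclotomicExponent p))) =
      PadicInt.toZModPow (n + cyclotomicExponent p)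
          (((x.1⁻¹ : rootsOfUnity (torsionOrder p) ℤ_[p]) : ℤ_[p]ˣ) : ℤ_[p]) *
        (cyclotomicGenerator p : ZMod (p ^ (n + cyclotomicExponent p))) ^ (-x.2).val := by
  refine Units.inv_eq_of_mul_eq_one_left ?_
  rw [classUnit_val]
  exact classMap_inv_mul n x.1 x.2

variable {μ ν : (n : ℕ) → ZMod (p ^ n) → ℚ_[p]}

/-- **The Riemann sums of a convolution** (level `n`, coefficient `k`): writing every unit modulo
`p^{n+e₀}` as a class `ηγ^s`,
`RS_{μ⋆ν}(k, n) = ∑_{x=(η₁,s₁)} ∑_{y=(η₂,s₂)} μ(η₁γ^{s₁}) ν(η₂γ^{s₂}) · ((s₂ + s₁ mod pⁿ) choose k)`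
(`ℓ(xy) = ℓ(x) + ℓ(y)`; the substitution `y = x⁻¹u` in `∑_u ∑_x μ(x)ν(x⁻¹u)(s(u) choose k)`,
`finsum_sum_classes_translate`). [cite: MazurTateTeitelbaum1986Invent, §I.13 (Riemann sums over the classes ηγ^s)] -/
private theorem riemannSum_unitsConv_eq [Fintype (rootsOfUnity (torsionOrder p) ℤ_[p])] (k n : ℕ) :
    distributionRiemannSum (unitsConv μ ν) k n =
      ∑ x : rootsOfUnity (torsionOrder p) ℤ_[p] × ZMod (p ^ n),
        ∑ y : rootsOfUnity (torsionOrder p) ℤ_[p] × ZMod (p ^ n),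
          μ (n + cyclotomicExponent p) (classUnit n x : ZMod (p ^ (n + cyclotomicExponent p))) *
            (ν (n + cyclotomicExponent p) (classUnit n y : ZMod (p ^ (n + cyclotomicExponent p))) *
              (((y.2 + x.2).val.choose k : ℕ) : ℚ_[p])) := by
  haveI : NeZero (p ^ n) := ⟨pow_ne_zero _ (Fact.out : p.Prime).ne_zero⟩
  -- the convolution at the unit `u = classUnit y`, as a sum over the classes `x`
  have hconv : ∀ y : rootsOfUnity (torsionOrder p) ℤ_[p] × ZMod (p ^ n),
      unitsConv μ ν (n + cyclotomicExponent p)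
          (classUnit n y : ZMod (p ^ (n + cyclotomicExponent p))) =
        ∑ x : rootsOfUnity (torsionOrder p) ℤ_[p] × ZMod (p ^ n),
          μ (n + cyclotomicExponent p) (classUnit n x : ZMod (p ^ (n + cyclotomicExponent p))) *
            ν (n + cyclotomicExponent p)
              ((((classUnit n x)⁻¹ : (ZMod (p ^ (n + cyclotomicExponent p)))ˣ) :
                  ZMod (p ^ (n + cyclotomicExponent p))) *
                (classUnit n y : ZMod (p ^ (n + cyclotomicExponent p)))) := by
    intro y
    rw [unitsConv]
    refine (Fintype.sum_bijective (classUnit n) (classUnit_bijective n) _ _ fun x ↦ ?_).symm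
    rw [mul_comm ((((classUnit n x)⁻¹ : (ZMod (p ^ (n + cyclotomicExponent p)))ˣ) :
      ZMod (p ^ (n + cyclotomicExponent p))))]
  -- the inner sum for fixed `x`: translation by `x⁻¹ = η₁⁻¹γ^{-s₁}`
  have hinner : ∀ x : rootsOfUnity (torsionOrder p) ℤ_[p] × ZMod (p ^ n),
      ∑ y : rootsOfUnity (torsionOrder p) ℤ_[p] × ZMod (p ^ n),
        ν (n + cyclotomicExponent p)
            ((((classUnit n x)⁻¹ : (ZMod (p ^ (n + cyclotomicExponent p)))ˣ) :
                ZMod (p ^ (n + cyclotomicExponent p))) *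
              (classUnit n y : ZMod (p ^ (n + cyclotomicExponent p)))) *
          ((y.2.val.choose k : ℕ) : ℚ_[p]) =
        ∑ y : rootsOfUnity (torsionOrder p) ℤ_[p] × ZMod (p ^ n),
          ν (n + cyclotomicExponent p) (classUnit n y : ZMod (p ^ (n + cyclotomicExponent p))) *
            (((y.2 + x.2).val.choose k : ℕ) : ℚ_[p]) := by
    intro x
    have h := finsum_sum_classes_translate (R := ℚ_[p]) n (ν (n + cyclotomicExponent p)) x.1⁻¹ (-x.2)
      (fun s : ZMod (p ^ n) ↦ ((s.val.choose k : ℕ) : ℚ_[p]))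
    rw [finsum_eq_sum_of_fintype, finsum_eq_sum_of_fintype, ← Fintype.sum_prod_type',
      ← Fintype.sum_prod_type'] at h
    simp only [sub_neg_eq_add] at h
    simp only [classUnit_val, classUnit_inv_val]
    exact h
  rw [distributionRiemannSum, finsum_eq_sum_of_fintype, ← Fintype.sum_prod_type']
  have h1 : ∀ y : rootsOfUnity (torsionOrder p) ℤ_[p] × ZMod (p ^ n),
      unitsConv μ ν (n + cyclotomicExponent p)
          (PadicInt.toZModPow (n + cyclotomicExponent p) ((y.1 : ℤ_[p]ˣ) : ℤ_[p]) *
            (cyclotomicGenerator p : ZMod (p ^ (n + cyclotomicExponent p))) ^ y.2.val) *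
          ((y.2.val.choose k : ℕ) : ℚ_[p]) =
        ∑ x : rootsOfUnity (torsionOrder p) ℤ_[p] × ZMod (p ^ n),
          μ (n + cyclotomicExponent p) (classUnit n x : ZMod (p ^ (n + cyclotomicExponent p))) *
            (ν (n + cyclotomicExponent p)
              ((((classUnit n x)⁻¹ : (ZMod (p ^ (n + cyclotomicExponent p)))ˣ) :
                  ZMod (p ^ (n + cyclotomicExponent p))) *
                (classUnit n y : ZMod (p ^ (n + cyclotomicExponent p)))) *
              ((y.2.val.choose k : ℕ) : ℚ_[p])) := by
    intro y
    rw [← classUnit_val n y, hconv y, Finset.sum_mul]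
    exact Fintype.sum_congr _ _ fun x ↦ mul_assoc _ _ _
  simp only [h1]
  rw [Finset.sum_comm]
  refine Fintype.sum_congr _ _ fun x ↦ ?_
  rw [← Finset.mul_sum, ← Finset.mul_sum, hinner x]

/-- **Vandermonde on the Riemann sums**: `∑_{i+j=k} RS_μ(i, n)·RS_ν(j, n) =
∑_{x=(η₁,s₁)} ∑_{y=(η₂,s₂)} μ(η₁γ^{s₁}) ν(η₂γ^{s₂}) · ((s₁ + s₂) choose k)` (sum of the representatives
in `ℕ`, no reduction modulo `pⁿ`). [folklore] -/
private theorem sum_antidiagonal_riemannSum_eq [Fintype (rootsOfUnity (torsionOrder p) ℤ_[p])]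
    (k n : ℕ) :
    ∑ ij ∈ Finset.HasAntidiagonal.antidiagonal k,
        distributionRiemannSum μ ij.1 n * distributionRiemannSum ν ij.2 n =
      ∑ x : rootsOfUnity (torsionOrder p) ℤ_[p] × ZMod (p ^ n),
        ∑ y : rootsOfUnity (torsionOrder p) ℤ_[p] × ZMod (p ^ n),
          μ (n + cyclotomicExponent p) (classUnit n x : ZMod (p ^ (n + cyclotomicExponent p))) *
            (ν (n + cyclotomicExponent p) (classUnit n y : ZMod (p ^ (n + cyclotomicExponent p))) *
              (((x.2.val + y.2.val).choose k : ℕ) : ℚ_[p])) := by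
  have hRS : ∀ (ρ : (n : ℕ) → ZMod (p ^ n) → ℚ_[p]) (i : ℕ), distributionRiemannSum ρ i n =
      ∑ x : rootsOfUnity (torsionOrder p) ℤ_[p] × ZMod (p ^ n),
        ρ (n + cyclotomicExponent p) (classUnit n x : ZMod (p ^ (n + cyclotomicExponent p))) *
          ((x.2.val.choose i : ℕ) : ℚ_[p]) := fun ρ i ↦ by
    rw [distributionRiemannSum, finsum_eq_sum_of_fintype, ← Fintype.sum_prod_type']
    exact Fintype.sum_congr _ _ fun x ↦ by rw [classUnit_val]
  simp only [hRS, Finset.sum_mul_sum]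
  rw [Finset.sum_comm]
  refine Fintype.sum_congr _ _ fun x ↦ ?_
  rw [Finset.sum_comm]
  refine Fintype.sum_congr _ _ fun y ↦ ?_
  rw [Nat.add_choose_eq, Nat.cast_sum, Finset.mul_sum, Finset.mul_sum]
  refine Finset.sum_congr rfl fun ij _ ↦ ?_
  rw [Nat.cast_mul]
  ring

/-- **The transform of a convolution is the product of the transforms**
(Lang Ch. 12 §1, PDF p. 187: "the product in `Λ_𝔬(Z)` corresponds to the convolution of measures";
Ch. 4 §1 Example 2: the power series of a measure on `Γ = γ^{ℤ_p}`): for bounded distributions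
`μ`, `ν` on `ℤ_p`,
`L_{μ ⋆ ν}(T) = ∫_{ℤ_p^×} (1+T)^{ℓ(x)} d(μ ⋆ ν)(x) = L_μ(T) · L_ν(T)` in `ℚ_p⟦T⟧`
(`ℓ(xy) = ℓ(x) + ℓ(y)`, so `(1+T)^{ℓ(xy)} = (1+T)^{ℓ(x)}(1+T)^{ℓ(y)}`).  In the tree's Riemann-sum
definition of the transform: the level-`n` Riemann sum of `[T^k]L_{μ⋆ν}` and
`∑_{i+j=k} RS_μ(i,n) RS_ν(j,n)` are the same double sum over pairs of classes except for the binomials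
`((s₂+s₁ mod pⁿ) choose k)` versus `((s₁+s₂) choose k)`, which are `p^{-n}/‖k!‖`-close
(`norm_choose_sub_choose_le`); so the difference has norm `≤ ‖μ‖‖ν‖p^{-n}/‖k!‖ → 0`, while the
latter converges to `∑_{i+j=k} [T^i]L_μ · [T^j]L_ν = [T^k](L_μ L_ν)` (`PowerSeries.coeff_mul`).
[cite: LangCyclotomic1990, Ch. 12 §1 (PDF p. 187) and Ch. 4 §1 Example 2 (PDF p. 79)]
[cite: MazurTateTeitelbaum1986Invent, §I.13] -/
theorem distributionTransform_unitsConv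
    (hμ : ∀ (n : ℕ) (a : ZMod (p ^ n)),
      ∑ b ∈ Finset.univ.filter (fun b : ZMod (p ^ (n + 1)) ↦
        ZMod.castHom (pow_dvd_pow p n.le_succ) (ZMod (p ^ n)) b = a), μ (n + 1) b = μ n a)
    {C : ℝ} (hC : ∀ (n : ℕ) (a : ZMod (p ^ n)), ‖μ n a‖ ≤ C)
    (hν : ∀ (n : ℕ) (a : ZMod (p ^ n)),
      ∑ b ∈ Finset.univ.filter (fun b : ZMod (p ^ (n + 1)) ↦
        ZMod.castHom (pow_dvd_pow p n.le_succ) (ZMod (p ^ n)) b = a), ν (n + 1) b = ν n a)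
    {D : ℝ} (hD : ∀ (n : ℕ) (a : ZMod (p ^ n)), ‖ν n a‖ ≤ D) :
    distributionTransform (unitsConv μ ν) = distributionTransform μ * distributionTransform ν := by
  haveI := neZero_torsionOrder p
  haveI := Fintype.ofFinite (rootsOfUnity (torsionOrder p) ℤ_[p])
  have hC0 : 0 ≤ C := (norm_nonneg _).trans (hC 0 0)
  have hD0 : 0 ≤ D := (norm_nonneg _).trans (hD 0 0)
  have hp1 : (1 : ℝ) < p := by exact_mod_cast (Fact.out : p.Prime).one_lt
  ext k
  rw [PowerSeries.coeff_mul, coeff_distributionTransform]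
  simp only [coeff_distributionTransform]
  -- the right-hand side is the limit of `v n = ∑_{i+j=k} RS_μ(i,n) RS_ν(j,n)`
  set v : ℕ → ℚ_[p] := fun n ↦
    ∑ ij ∈ Finset.HasAntidiagonal.antidiagonal k,
      distributionRiemannSum μ ij.1 n * distributionRiemannSum ν ij.2 n with hv_def
  have hv : Tendsto v atTop (𝓝 (∑ ij ∈ Finset.HasAntidiagonal.antidiagonal k,
      limUnder atTop (distributionRiemannSum μ ij.1) *
        limUnder atTop (distributionRiemannSum ν ij.2))) := by
    refine tendsto_finsetSum _ fun ij _ ↦ ?_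
    have h1 := tendsto_distributionRiemannSum hμ hC ij.1
    have h2 := tendsto_distributionRiemannSum hν hD ij.2
    rw [coeff_distributionTransform] at h1 h2
    exact h1.mul h2
  refine Tendsto.limUnder_eq ?_
  -- it suffices that `RS_{μ⋆ν}(k, n) − v n → 0`
  suffices hdiff : Tendsto (fun n ↦ distributionRiemannSum (unitsConv μ ν) k n - v n) atTop (𝓝 0) by
    have := hdiff.add hv
    simpa using this
  have hbound : ∀ n, ‖distributionRiemannSum (unitsConv μ ν) k n - v n‖ ≤
      C * D * ((p : ℝ) ^ (-n : ℤ) / ‖((k.factorial : ℕ) : ℚ_[p])‖) := by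
    intro n
    haveI : NeZero (p ^ n) := ⟨pow_ne_zero _ (Fact.out : p.Prime).ne_zero⟩
    rw [hv_def]
    dsimp only
    rw [riemannSum_unitsConv_eq, sum_antidiagonal_riemannSum_eq, ← Finset.sum_sub_distrib]
    refine IsUltrametricDist.norm_sum_le_of_forall_le_of_nonneg (by positivity) fun x _ ↦ ?_
    rw [← Finset.sum_sub_distrib]
    refine IsUltrametricDist.norm_sum_le_of_forall_le_of_nonneg (by positivity) fun y _ ↦ ?_
    rw [← mul_sub, ← mul_sub, norm_mul, norm_mul, mul_assoc]
    refine mul_le_mul (hC _ _) (mul_le_mul (hD _ _) ?_ (norm_nonneg _) hD0) (by positivity) hC0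
    refine norm_choose_sub_choose_le k ?_
    rw [ZMod.val_add]
    exact (Nat.mod_modEq _ _).trans (by rw [Nat.add_comm])
  have h0 : Tendsto (fun n : ℕ ↦ (p : ℝ) ^ (-n : ℤ)) atTop (𝓝 0) := by
    have h := tendsto_pow_atTop_nhds_zero_of_lt_one (r := ((p : ℝ))⁻¹) (by positivity)
      (inv_lt_one_of_one_lt₀ hp1)
    refine h.congr fun n ↦ ?_
    rw [zpow_neg, zpow_natCast, inv_pow]
  have hK : Tendsto (fun n : ℕ ↦ C * D * ((p : ℝ) ^ (-n : ℤ) / ‖((k.factorial : ℕ) : ℚ_[p])‖))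
      atTop (𝓝 0) := by
    simpa using (h0.div_const ‖((k.factorial : ℕ) : ℚ_[p])‖).const_mul (C * D)
  exact squeeze_zero_norm hbound hK

/-- **Convergence of the Riemann sums of a convolution** to the coefficients of the product of the
transforms. [cite: LangCyclotomic1990, Ch. 12 §1 (PDF p. 187)] [cite: MazurTateTeitelbaum1986Invent, §I.13] -/
theorem tendsto_distributionRiemannSum_unitsConv
    (hμ : ∀ (n : ℕ) (a : ZMod (p ^ n)),
      ∑ b ∈ Finset.univ.filter (fun b : ZMod (p ^ (n + 1)) ↦
        ZMod.castHom (pow_dvd_pow p n.le_succ) (ZMod (p ^ n)) b = a), μ (n + 1) b = μ n a)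
    (hμ0 : ∀ n : ℕ, 1 ≤ n → ∀ a : ZMod (p ^ n), ¬ IsUnit a → μ n a = 0)
    {C : ℝ} (hC : ∀ (n : ℕ) (a : ZMod (p ^ n)), ‖μ n a‖ ≤ C)
    (hν : ∀ (n : ℕ) (a : ZMod (p ^ n)),
      ∑ b ∈ Finset.univ.filter (fun b : ZMod (p ^ (n + 1)) ↦
        ZMod.castHom (pow_dvd_pow p n.le_succ) (ZMod (p ^ n)) b = a), ν (n + 1) b = ν n a)
    {D : ℝ} (hD : ∀ (n : ℕ) (a : ZMod (p ^ n)), ‖ν n a‖ ≤ D) (k : ℕ) :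
    Tendsto (distributionRiemannSum (unitsConv μ ν) k) atTop
      (𝓝 (PowerSeries.coeff k (distributionTransform μ * distributionTransform ν))) := by
  rw [← distributionTransform_unitsConv hμ hC hν hD]
  exact tendsto_distributionRiemannSum (unitsConv_distribution hμ hμ0 hν) (norm_unitsConv_le hC hD) k

end Transform

/-! ## §4 At `p = 2`: the smoothed Dedekind–Eisenstein measure `(χ₋₄E_{1,5})ˇ ⋆ (χ₋₄E_{1,5})` and
its transform `G(T^ι)·G(T)` -/

section KubotaLeopoldtTwo

/-- **The smoothed Dedekind–Eisenstein measure at `2`**: the convolution on `ℤ₂^×` of the inverted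
measure `(χ₋₄E_{1,5})ˇ` with `χ₋₄E_{1,5}` (tree `klTwoMeasureInv`, `klTwoMeasure`):
`(a + 2ⁿℤ₂) ↦ ∑_{x ∈ (ℤ/2ⁿ)^×} (χ₋₄E_{1,5})(x⁻¹)·(χ₋₄E_{1,5})(a x⁻¹)`.  Since
`E_{1,5} = (1 − 5·[5]_*)E₁` (Lang Ch. 2 §2), this is `(1 − 5σ(5))(1 − 5σ(5)⁻¹)` applied to the
convolution `(χ₋₄B₁)ˇ ⋆ (χ₋₄B₁)` of the unregularised first Bernoulli distributions — Stevens' smoothing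
`Sm_{r₁}^{r₂}`, `r₁ = r₂ = 5`, of the Dedekind-symbol distribution whose values are the Dedekind sums
`∑_i B₁(i/m)B₁(hi/m)` (an abbreviation, no new notion).
[cite: Stevens1982, §5.4 (PDF p. 73, Sm_{r₁}^{r₂} and Prop. 5.4.1) and §5.2 (PDF pp. 68–69, Sm_r λ_B)]
[cite: LangCyclotomic1990, Ch. 12 §1 (PDF p. 187) and Ch. 2 §2 (E_{1,c})] -/
abbrev klTwoConv : (n : ℕ) → ZMod (2 ^ n) → ℚ_[2] :=
  unitsConv klTwoMeasureInv klTwoMeasure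

/-- `(χ₋₄E_{1,5})ˇ` vanishes on the non-unit classes (by definition of the inversion).
[cite: LangCyclotomic1990, Ch. 4 §2 (PDF pp. 80–82) (unfolding)] -/
theorem klTwoMeasureInv_eq_zero_of_not_isUnit (n : ℕ) (_hn : 1 ≤ n) (a : ZMod (2 ^ n))
    (ha : ¬ IsUnit a) : klTwoMeasureInv n a = 0 :=
  klTwoMeasureInv_apply_of_not_isUnit ha

/-- **The smoothed Dedekind–Eisenstein measure at `2` satisfies the distribution relation.**
[cite: Stevens1982, §5.4 Prop. 5.4.1 (PDF p. 73)] [cite: LangCyclotomic1990, Ch. 12 §1 (PDF p. 187)] -/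
theorem klTwoConv_distribution (n : ℕ) (a : ZMod (2 ^ n)) :
    ∑ b ∈ Finset.univ.filter (fun b : ZMod (2 ^ (n + 1)) ↦
        ZMod.castHom (pow_dvd_pow 2 n.le_succ) (ZMod (2 ^ n)) b = a), klTwoConv (n + 1) b =
      klTwoConv n a :=
  unitsConv_distribution klTwoMeasureInv_distribution klTwoMeasureInv_eq_zero_of_not_isUnit
    klTwoMeasure_distribution n a

/-- **The smoothed Dedekind–Eisenstein measure at `2` is bounded by `1`** (Stevens Prop. 5.4.1: "is a
measure"). [cite: Stevens1982, §5.4 Prop. 5.4.1 (PDF p. 73)] [cite: LangCyclotomic1990, Ch. 2 §2 Thm. 2.1 (i)] -/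
theorem norm_klTwoConv_le_one (n : ℕ) (a : ZMod (2 ^ n)) : ‖klTwoConv n a‖ ≤ 1 := by
  have h := norm_unitsConv_le norm_klTwoMeasureInv_le_one norm_klTwoMeasure_le_one n a
  rwa [one_mul] at h

/-- The smoothed Dedekind–Eisenstein measure at `2` vanishes on the even classes of positive level.
[cite: Stevens1982, §5.4 (PDF p. 73)] [cite: LangCyclotomic1990, Ch. 4 §3 (χ extended by 0, PDF p. 84)] -/
theorem klTwoConv_eq_zero_of_not_isUnit {n : ℕ} (hn : 1 ≤ n) {a : ZMod (2 ^ n)}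
    (ha : ¬ IsUnit a) : klTwoConv n a = 0 :=
  unitsConv_eq_zero_of_not_isUnit (fun _ hn a ha ↦ klTwoMeasure_eq_zero_of_not_isUnit hn a ha) hn ha

/-- The smoothed Dedekind–Eisenstein measure at `2` is even. [cite: Stevens1982, §5.4 (PDF p. 73)]
[cite: LangCyclotomic1990, Ch. 2 §2 (E_{1,c} odd, B 2; PDF pp. 39–41)] -/
theorem klTwoConv_neg (n : ℕ) (a : ZMod (2 ^ n)) : klTwoConv n (-a) = klTwoConv n a :=
  unitsConv_neg klTwoMeasure_neg n a

/-- The two factors commute: `(χ₋₄E_{1,5})ˇ ⋆ (χ₋₄E_{1,5}) = (χ₋₄E_{1,5}) ⋆ (χ₋₄E_{1,5})ˇ`.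
[cite: LangCyclotomic1990, Ch. 12 §1 (PDF p. 187)] -/
theorem klTwoConv_comm : klTwoConv = unitsConv klTwoMeasure klTwoMeasureInv :=
  unitsConv_comm klTwoMeasureInv_eq_zero_of_not_isUnit
    (fun _ hn a ha ↦ klTwoMeasure_eq_zero_of_not_isUnit hn a ha)

/-- **The transform of the smoothed Dedekind–Eisenstein measure at `2` is the product of the two
`2`-adic Kubota–Leopoldt numerators**: `L_{(χ₋₄E_{1,5})ˇ ⋆ (χ₋₄E_{1,5})}(T) = G(T^ι) · G(T)`
(`= klTwoNumeratorInv * klTwoNumerator`) — the `p = 2`, trivial-tame-character shape of Stevens'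
factorisation of the `p`-adic `L`-function of a weight-2 Eisenstein series into
`L_p(ε̄₁χω, 1 − s)·L_p(ε₂χ̄ω, s − 1)` (end of §5.4), here as an identity of power series for the
smoothed measure itself (no division by `(1 − r₁⟨r₁⟩^{s−1})(1 − r₂⟨r₂⟩^{1−s})`, which is not
invertible at `p = 2`).
[cite: Stevens1982, §5.4 (PDF p. 74, L_p(E,χ,s) = ε₁(Δ)χ̄(N₁)⟨N₁⟩^{1−s} L_p(ε̄₁χω,1−s) L_p(ε₂χ̄ω,s−1)) and Prop. 5.4.1 (PDF p. 73)]
[cite: LangCyclotomic1990, Ch. 12 §1 (PDF p. 187) and Ch. 4 §3 (PDF p. 84)] -/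
theorem distributionTransform_klTwoConv :
    distributionTransform klTwoConv = klTwoNumeratorInv * klTwoNumerator :=
  distributionTransform_unitsConv klTwoMeasureInv_distribution norm_klTwoMeasureInv_le_one
    klTwoMeasure_distribution norm_klTwoMeasure_le_one

/-- **The Riemann sums of the smoothed Dedekind–Eisenstein measure at `2` converge to the
coefficients of `G(T^ι)·G(T)`.** [cite: Stevens1982, §5.4 (PDF pp. 73–74)] [cite: MazurTateTeitelbaum1986Invent, §I.13] -/
theorem tendsto_distributionRiemannSum_klTwoConv (k : ℕ) :
    Tendsto (distributionRiemannSum klTwoConv k) atTop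
      (𝓝 (PowerSeries.coeff k (klTwoNumeratorInv * klTwoNumerator))) := by
  rw [← distributionTransform_klTwoConv]
  exact tendsto_distributionRiemannSum klTwoConv_distribution norm_klTwoConv_le_one k

/-- **`½·½·G(T^ι)G(T) ∈ Λ` with constant term `1`**: with the halves `G₀^ι`, `G₀ ∈ ℤ₂⟦T⟧` of
`KubotaLeopoldtTwoNumerator.lean` §5, the transform of the smoothed Dedekind–Eisenstein measure is
`4·ι(G₀^ι·G₀)` and `(G₀^ι G₀)(0) = 1` — the unit-content normalisation consumed by the mod-2 reading.
[cite: Stevens1982, §5.4 (PDF pp. 73–74)] [cite: MazurTateTeitelbaum1986Invent, §I.12–I.13 (p = 2)] -/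
theorem exists_iwasawa_quarter_klTwoConv :
    ∃ H₀ : IwasawaAlgebra 2,
      iwasawaToPowerSeries 2 H₀ = PowerSeries.C (4⁻¹ : ℚ_[2]) * distributionTransform klTwoConv ∧
        PowerSeries.constantCoeff H₀ = 1 := by
  obtain ⟨GI₀, hGI, hGI0⟩ := exists_iwasawa_half_klTwoNumeratorInv
  obtain ⟨G₀, hG, hG0⟩ := exists_iwasawa_half_klTwoNumerator
  refine ⟨GI₀ * G₀, ?_, ?_⟩
  · rw [map_mul, hGI, hG, distributionTransform_klTwoConv]
    have h4 : (4⁻¹ : ℚ_[2]) = 2⁻¹ * 2⁻¹ := by norm_num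
    rw [h4, map_mul]
    ring
  · rw [map_mul, hGI0, hG0, mul_one]

end KubotaLeopoldtTwo

/-! ## §5 Algebra of the convolution: bilinearity, the dilations `[c]_*`, `[c]^*` and their
transforms `(1+T)^{±ℓ(c)}·L`, and Stevens' smoothing `Sm_c = 1 − c·[c]_*` on Bernoulli distributions

(Appended.)  Lang Ch. 4 §2 lists the operations on measures and the corresponding operations on
power series; Stevens §5.2 (PDF pp. 68–69) smooths the Bernoulli distribution `λ_B` by
`Sm_r = 1 − rσ(r)`, `σ(r)` the group element of `r`, and §5.4 the Eisenstein distribution by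
`Sm_{r₁}^{r₂} = (1 − r₁σ(r₁))(1 − r₂σ(r₂)⁻¹)`.  Here: `⋆` is bilinear; the push-forward
`dilate c μ = [c]_*μ` (`a ↦ μ(a c⁻¹)`) and pull-back `codilate c μ = [c]^*μ` (`a ↦ μ(a c)`) along
multiplication by a natural number `c` prime to `p` commute with `⋆`, are exchanged by the inversion
`μ ↦ μ̌`, preserve distributions and bounds, and multiply the transform by `(1+T)^{ℓ(c)}` resp.
`(1+T)^{−ℓ(c)}` (`c = ω(c)γ^{ℓ(c)}`; `PAdicMeasureTransformTranslationProofs`); the regularised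
Bernoulli measure of the tree is `E_{k,c}^θ = (1 − c^kθ(c)·[c]_*)E_k^θ` on the unregularised
`θ`-twisted Bernoulli distribution `bernoulliDistribution` (Lang Ch. 2 §2: `E_{k,c} = E_k − c^k E_k∘c⁻¹`),
and at `p = 2`: `klTwoConv = Sm_5^5((χ₋₄E₁)ˇ ⋆ (χ₋₄E₁))` with `Sm_5^5 = (1 − 5[5]_*)(1 − 5[5]^*)` —
Stevens' Prop. 5.4.1 smoothing, verbatim, of the (unbounded) Dedekind-type convolution. -/

section Algebra

variable {μ μ₁ μ₂ ν ν₁ ν₂ : (n : ℕ) → ZMod (p ^ n) → ℚ_[p]}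

/-! ### Bilinearity -/

/-- `(μ₁ + μ₂) ⋆ ν = μ₁ ⋆ ν + μ₂ ⋆ ν`. [cite: LangCyclotomic1990, Ch. 12 §1 (PDF p. 187: Λ_o(Z) is a ring; product = convolution)] -/
theorem unitsConv_add_left : unitsConv (μ₁ + μ₂) ν = unitsConv μ₁ ν + unitsConv μ₂ ν := by
  funext n a
  simp only [unitsConv, Pi.add_apply, add_mul, Finset.sum_add_distrib]

/-- `μ ⋆ (ν₁ + ν₂) = μ ⋆ ν₁ + μ ⋆ ν₂`. [cite: LangCyclotomic1990, Ch. 12 §1 (PDF p. 187)] -/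
theorem unitsConv_add_right : unitsConv μ (ν₁ + ν₂) = unitsConv μ ν₁ + unitsConv μ ν₂ := by
  funext n a
  simp only [unitsConv, Pi.add_apply, mul_add, Finset.sum_add_distrib]

/-- `(μ₁ − μ₂) ⋆ ν = μ₁ ⋆ ν − μ₂ ⋆ ν`. [cite: LangCyclotomic1990, Ch. 12 §1 (PDF p. 187)] -/
theorem unitsConv_sub_left : unitsConv (μ₁ - μ₂) ν = unitsConv μ₁ ν - unitsConv μ₂ ν := by
  funext n a
  simp only [unitsConv, Pi.sub_apply, sub_mul, Finset.sum_sub_distrib]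

/-- `μ ⋆ (ν₁ − ν₂) = μ ⋆ ν₁ − μ ⋆ ν₂`. [cite: LangCyclotomic1990, Ch. 12 §1 (PDF p. 187)] -/
theorem unitsConv_sub_right : unitsConv μ (ν₁ - ν₂) = unitsConv μ ν₁ - unitsConv μ ν₂ := by
  funext n a
  simp only [unitsConv, Pi.sub_apply, mul_sub, Finset.sum_sub_distrib]

/-- `(r·μ) ⋆ ν = r·(μ ⋆ ν)`. [cite: LangCyclotomic1990, Ch. 12 §1 (PDF p. 187)] -/
theorem unitsConv_smul_left (r : ℚ_[p]) : unitsConv (r • μ) ν = r • unitsConv μ ν := by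
  funext n a
  simp only [unitsConv, Pi.smul_apply, smul_eq_mul, mul_assoc, Finset.mul_sum]

/-- `μ ⋆ (r·ν) = r·(μ ⋆ ν)`. [cite: LangCyclotomic1990, Ch. 12 §1 (PDF p. 187)] -/
theorem unitsConv_smul_right (r : ℚ_[p]) : unitsConv μ (r • ν) = r • unitsConv μ ν := by
  funext n a
  simp only [unitsConv, Pi.smul_apply, smul_eq_mul, Finset.mul_sum]
  exact Finset.sum_congr rfl fun x _ ↦ by ring

/-! ### The dilations `[c]_*` (push-forward) and `[c]^*` (pull-back) along `x ↦ c·x` -/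

/-- **Push-forward along multiplication by `c`**: `([c]_*μ)(a + pⁿℤ_p) = μ(a·c⁻¹ + pⁿℤ_p)`
(`c⁻¹` the inverse of `c` in `ℤ/pⁿ`, for `c` prime to `p`; Stevens' `σ(c)·μ`, Lang's `μ ∘ c⁻¹`
as in `E_{k,c} = E_k − c^k E_k ∘ c⁻¹`).
[cite: Stevens1982, §5.2 (PDF pp. 68–69, σ(r) and Sm_r = 1 − rσ(r))] [cite: LangCyclotomic1990, Ch. 2 §2 (E_{k,c}) and Ch. 4 §2 (PDF pp. 80–82)] -/
def dilate (c : ℕ) (μ : (n : ℕ) → ZMod (p ^ n) → ℚ_[p]) (n : ℕ) (a : ZMod (p ^ n)) : ℚ_[p] :=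
  μ n (a * (c : ZMod (p ^ n))⁻¹)

/-- **Pull-back along multiplication by `c`**: `([c]^*μ)(a + pⁿℤ_p) = μ(a·c + pⁿℤ_p)` (`= σ(c)⁻¹·μ`).
[cite: Stevens1982, §5.4 (PDF p. 73, σ(r₂)⁻¹ in Sm_{r₁}^{r₂})] [cite: LangCyclotomic1990, Ch. 4 §2 (PDF pp. 80–82)] -/
def codilate (c : ℕ) (μ : (n : ℕ) → ZMod (p ^ n) → ℚ_[p]) (n : ℕ) (a : ZMod (p ^ n)) : ℚ_[p] :=
  μ n (a * (c : ZMod (p ^ n)))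

/-- Unfolding of `dilate`. [cite: Stevens1982, §5.2 (PDF pp. 68–69) (unfolding)] -/
theorem dilate_apply (c : ℕ) (n : ℕ) (a : ZMod (p ^ n)) :
    dilate c μ n a = μ n (a * (c : ZMod (p ^ n))⁻¹) :=
  rfl

/-- Unfolding of `codilate`. [cite: Stevens1982, §5.4 (PDF p. 73) (unfolding)] -/
theorem codilate_apply (c : ℕ) (n : ℕ) (a : ZMod (p ^ n)) :
    codilate c μ n a = μ n (a * (c : ZMod (p ^ n))) :=
  rfl

omit [Fact p.Prime] in
/-- `c` prime to `p` is prime to every `pⁿ`. [folklore] -/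
private theorem coprime_pow_of_coprime {c : ℕ} (hc : p.Coprime c) (n : ℕ) : c.Coprime (p ^ n) :=
  Nat.Coprime.pow_right n hc.symm

omit [Fact p.Prime] in
/-- `c·c⁻¹ = 1` in `ℤ/pⁿ` for `c` prime to `p`. [folklore] -/
private theorem natCast_mul_inv_eq_one {c : ℕ} (hc : p.Coprime c) (n : ℕ) :
    (c : ZMod (p ^ n)) * (c : ZMod (p ^ n))⁻¹ = 1 :=
  ZMod.coe_mul_inv_eq_one c (coprime_pow_of_coprime hc n)

/-- `[c]^*[c]_* = 1`. [cite: LangCyclotomic1990, Ch. 4 §2 (PDF pp. 80–82)] -/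
theorem codilate_dilate {c : ℕ} (hc : p.Coprime c) : codilate c (dilate c μ) = μ := by
  funext n a
  rw [codilate, dilate, mul_assoc, natCast_mul_inv_eq_one hc, mul_one]

/-- `[c]_*[c]^* = 1`. [cite: LangCyclotomic1990, Ch. 4 §2 (PDF pp. 80–82)] -/
theorem dilate_codilate {c : ℕ} (hc : p.Coprime c) : dilate c (codilate c μ) = μ := by
  funext n a
  rw [dilate, codilate, mul_assoc, mul_comm ((c : ZMod (p ^ n))⁻¹), natCast_mul_inv_eq_one hc,
    mul_one]

/-- `[1]_* = 1`. [cite: LangCyclotomic1990, Ch. 4 §2 (PDF pp. 80–82)] -/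
theorem dilate_one : dilate 1 μ = μ := by
  funext n a
  rw [dilate, Nat.cast_one, ZMod.inv_one, mul_one]

/-- `[1]^* = 1`. [cite: LangCyclotomic1990, Ch. 4 §2 (PDF pp. 80–82)] -/
theorem codilate_one : codilate 1 μ = μ := by
  funext n a
  rw [codilate, Nat.cast_one, mul_one]

/-- `[c]_*` is additive. [cite: LangCyclotomic1990, Ch. 4 §2 (PDF pp. 80–82)] -/
theorem dilate_add (c : ℕ) : dilate c (μ₁ + μ₂) = dilate c μ₁ + dilate c μ₂ := by
  funext n a; rfl

/-- `[c]_*` commutes with subtraction. [cite: LangCyclotomic1990, Ch. 4 §2 (PDF pp. 80–82)] -/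
theorem dilate_sub (c : ℕ) : dilate c (μ₁ - μ₂) = dilate c μ₁ - dilate c μ₂ := by
  funext n a; rfl

/-- `[c]_*` is homogeneous. [cite: LangCyclotomic1990, Ch. 4 §2 (PDF pp. 80–82)] -/
theorem dilate_smul (c : ℕ) (r : ℚ_[p]) : dilate c (r • μ) = r • dilate c μ := by
  funext n a; rfl

/-- `[c]^*` is additive. [cite: LangCyclotomic1990, Ch. 4 §2 (PDF pp. 80–82)] -/
theorem codilate_add (c : ℕ) : codilate c (μ₁ + μ₂) = codilate c μ₁ + codilate c μ₂ := by
  funext n a; rfl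

/-- `[c]^*` commutes with subtraction. [cite: LangCyclotomic1990, Ch. 4 §2 (PDF pp. 80–82)] -/
theorem codilate_sub (c : ℕ) : codilate c (μ₁ - μ₂) = codilate c μ₁ - codilate c μ₂ := by
  funext n a; rfl

/-- `[c]^*` is homogeneous. [cite: LangCyclotomic1990, Ch. 4 §2 (PDF pp. 80–82)] -/
theorem codilate_smul (c : ℕ) (r : ℚ_[p]) : codilate c (r • μ) = r • codilate c μ := by
  funext n a; rfl

/-- `[c]_*` preserves bounds. [cite: LangCyclotomic1990, Ch. 4 §1 (norm of a measure, PDF pp. 77–78)] -/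
theorem norm_dilate_le (c : ℕ) {C : ℝ} (hC : ∀ (n : ℕ) (a : ZMod (p ^ n)), ‖μ n a‖ ≤ C) (n : ℕ)
    (a : ZMod (p ^ n)) : ‖dilate c μ n a‖ ≤ C :=
  hC n _

/-- `[c]^*` preserves bounds. [cite: LangCyclotomic1990, Ch. 4 §1 (norm of a measure, PDF pp. 77–78)] -/
theorem norm_codilate_le (c : ℕ) {C : ℝ} (hC : ∀ (n : ℕ) (a : ZMod (p ^ n)), ‖μ n a‖ ≤ C) (n : ℕ)
    (a : ZMod (p ^ n)) : ‖codilate c μ n a‖ ≤ C :=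
  hC n _

/-- `[c]_*` of an even set function is even. [cite: LangCyclotomic1990, Ch. 4 §2 (PDF pp. 80–82)] -/
theorem dilate_neg (c : ℕ) (hμ : ∀ (n : ℕ) (a : ZMod (p ^ n)), μ n (-a) = μ n a) (n : ℕ)
    (a : ZMod (p ^ n)) : dilate c μ n (-a) = dilate c μ n a := by
  rw [dilate, dilate, neg_mul, hμ]

/-- `[c]^*` of an even set function is even. [cite: LangCyclotomic1990, Ch. 4 §2 (PDF pp. 80–82)] -/
theorem codilate_neg (c : ℕ) (hμ : ∀ (n : ℕ) (a : ZMod (p ^ n)), μ n (-a) = μ n a) (n : ℕ)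
    (a : ZMod (p ^ n)) : codilate c μ n (-a) = codilate c μ n a := by
  rw [codilate, codilate, neg_mul, hμ]

/-- For `c` prime to `p`, `a·c⁻¹` is a unit iff `a` is. [folklore] -/
private theorem isUnit_mul_inv_natCast_iff {c : ℕ} (hc : p.Coprime c) {n : ℕ} (a : ZMod (p ^ n)) :
    IsUnit (a * (c : ZMod (p ^ n))⁻¹) ↔ IsUnit a := by
  have hu : IsUnit ((c : ZMod (p ^ n))⁻¹) :=
    IsUnit.of_mul_eq_one _ (by rw [mul_comm, natCast_mul_inv_eq_one hc])
  refine ⟨fun h ↦ ?_, fun h ↦ h.mul hu⟩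
  have h' := h.mul ((ZMod.unitOfCoprime c (coprime_pow_of_coprime hc n)).isUnit)
  rwa [ZMod.coe_unitOfCoprime, mul_assoc, mul_comm ((c : ZMod (p ^ n))⁻¹),
    natCast_mul_inv_eq_one hc, mul_one] at h'

/-- For `c` prime to `p`, `a·c` is a unit iff `a` is. [folklore] -/
private theorem isUnit_mul_natCast_iff {c : ℕ} (hc : p.Coprime c) {n : ℕ} (a : ZMod (p ^ n)) :
    IsUnit (a * (c : ZMod (p ^ n))) ↔ IsUnit a := by
  have hu : IsUnit (c : ZMod (p ^ n)) := by
    rw [← ZMod.coe_unitOfCoprime c (coprime_pow_of_coprime hc n)]; exact Units.isUnit _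
  refine ⟨fun h ↦ ?_, fun h ↦ h.mul hu⟩
  have h' := h.mul (IsUnit.of_mul_eq_one _ (by rw [mul_comm, natCast_mul_inv_eq_one hc]) :
    IsUnit ((c : ZMod (p ^ n))⁻¹))
  rwa [mul_assoc, natCast_mul_inv_eq_one hc, mul_one] at h'

/-- `[c]_*` preserves "no mass on the non-unit classes of positive level" (`c` prime to `p`).
[cite: LangCyclotomic1990, Ch. 4 §2 (PDF pp. 80–82)] -/
theorem dilate_eq_zero_of_not_isUnit {c : ℕ} (hc : p.Coprime c)
    (hμ0 : ∀ n : ℕ, 1 ≤ n → ∀ a : ZMod (p ^ n), ¬ IsUnit a → μ n a = 0) (n : ℕ) (hn : 1 ≤ n)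
    (a : ZMod (p ^ n)) (ha : ¬ IsUnit a) : dilate c μ n a = 0 :=
  hμ0 n hn _ (fun h ↦ ha ((isUnit_mul_inv_natCast_iff hc a).mp h))

/-- `[c]^*` preserves "no mass on the non-unit classes of positive level" (`c` prime to `p`).
[cite: LangCyclotomic1990, Ch. 4 §2 (PDF pp. 80–82)] -/
theorem codilate_eq_zero_of_not_isUnit {c : ℕ} (hc : p.Coprime c)
    (hμ0 : ∀ n : ℕ, 1 ≤ n → ∀ a : ZMod (p ^ n), ¬ IsUnit a → μ n a = 0) (n : ℕ) (hn : 1 ≤ n)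
    (a : ZMod (p ^ n)) (ha : ¬ IsUnit a) : codilate c μ n a = 0 :=
  hμ0 n hn _ (fun h ↦ ha ((isUnit_mul_natCast_iff hc a).mp h))

/-- **Translating a fibre by a unit**: for a distribution `ν` and a unit `y` modulo `p^{n+1}`,
`∑_{b ≡ a (pⁿ)} ν(b·y + p^{n+1}ℤ_p) = ν(a·ȳ + pⁿℤ_p)` (`b ↦ b·y` carries the fibre of `a` onto the
fibre of `a·ȳ`). [cite: LangCyclotomic1990, Ch. 12 §1 (PDF p. 187, compatible families)] -/
theorem sum_fiber_mul_unit_of_distribution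
    (hν : ∀ (n : ℕ) (a : ZMod (p ^ n)),
      ∑ b ∈ Finset.univ.filter (fun b : ZMod (p ^ (n + 1)) ↦
        ZMod.castHom (pow_dvd_pow p n.le_succ) (ZMod (p ^ n)) b = a), ν (n + 1) b = ν n a)
    (n : ℕ) (a : ZMod (p ^ n)) (y : (ZMod (p ^ (n + 1)))ˣ) :
    ∑ b ∈ Finset.univ.filter (fun b : ZMod (p ^ (n + 1)) ↦
        ZMod.castHom (pow_dvd_pow p n.le_succ) (ZMod (p ^ n)) b = a),
      ν (n + 1) (b * (y : ZMod (p ^ (n + 1)))) =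
      ν n (a * ZMod.castHom (pow_dvd_pow p n.le_succ) (ZMod (p ^ n)) (y : ZMod (p ^ (n + 1)))) := by
  rw [← hν n (a * ZMod.castHom (pow_dvd_pow p n.le_succ) (ZMod (p ^ n)) (y : ZMod (p ^ (n + 1))))]
  have hyinv : ZMod.castHom (pow_dvd_pow p n.le_succ) (ZMod (p ^ n)) (y : ZMod (p ^ (n + 1))) *
      ZMod.castHom (pow_dvd_pow p n.le_succ) (ZMod (p ^ n)) ((y⁻¹ : (ZMod (p ^ (n + 1)))ˣ) : ZMod _) = 1 := by
    rw [← map_mul, Units.mul_inv, map_one]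
  refine Finset.sum_nbij' (fun b ↦ b * (y : ZMod (p ^ (n + 1))))
    (fun c ↦ c * ((y⁻¹ : (ZMod (p ^ (n + 1)))ˣ) : ZMod (p ^ (n + 1)))) (fun b hb ↦ ?_) (fun c hc ↦ ?_)
    (fun b _ ↦ ?_) (fun c _ ↦ ?_) (fun b _ ↦ rfl)
  · simp only [Finset.mem_filter, Finset.mem_univ, true_and] at hb ⊢
    rw [map_mul, hb]
  · simp only [Finset.mem_filter, Finset.mem_univ, true_and] at hc ⊢
    rw [map_mul, hc, mul_assoc, hyinv, mul_one]
  · rw [mul_assoc, Units.mul_inv, mul_one]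
  · rw [mul_assoc, Units.inv_mul, mul_one]

/-- **`[c]_*` preserves the distribution relation** (`c` prime to `p`).
[cite: LangCyclotomic1990, Ch. 4 §2 (PDF pp. 80–82) and Ch. 12 §1 (PDF p. 187)] -/
theorem dilate_distribution {c : ℕ} (hc : p.Coprime c)
    (hμ : ∀ (n : ℕ) (a : ZMod (p ^ n)),
      ∑ b ∈ Finset.univ.filter (fun b : ZMod (p ^ (n + 1)) ↦
        ZMod.castHom (pow_dvd_pow p n.le_succ) (ZMod (p ^ n)) b = a), μ (n + 1) b = μ n a)
    (n : ℕ) (a : ZMod (p ^ n)) :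
    ∑ b ∈ Finset.univ.filter (fun b : ZMod (p ^ (n + 1)) ↦
        ZMod.castHom (pow_dvd_pow p n.le_succ) (ZMod (p ^ n)) b = a), dilate c μ (n + 1) b =
      dilate c μ n a := by
  set u : (ZMod (p ^ (n + 1)))ˣ := ZMod.unitOfCoprime c (coprime_pow_of_coprime hc (n + 1)) with hu
  have huinv : ((u⁻¹ : (ZMod (p ^ (n + 1)))ˣ) : ZMod (p ^ (n + 1))) = (c : ZMod (p ^ (n + 1)))⁻¹ := rfl
  have hred : ZMod.castHom (pow_dvd_pow p n.le_succ) (ZMod (p ^ n))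
      ((u⁻¹ : (ZMod (p ^ (n + 1)))ˣ) : ZMod (p ^ (n + 1))) = (c : ZMod (p ^ n))⁻¹ := by
    refine (ZMod.inv_eq_of_mul_eq_one _ _ _ ?_).symm
    rw [huinv, ← map_natCast (ZMod.castHom (pow_dvd_pow p n.le_succ) (ZMod (p ^ n))) c, ← map_mul,
      natCast_mul_inv_eq_one hc, map_one]
  simp only [dilate]
  rw [← hred, ← huinv]
  exact sum_fiber_mul_unit_of_distribution hμ n a u⁻¹

/-- **`[c]^*` preserves the distribution relation.**
[cite: LangCyclotomic1990, Ch. 4 §2 (PDF pp. 80–82) and Ch. 12 §1 (PDF p. 187)] -/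
theorem codilate_distribution {c : ℕ} (hc : p.Coprime c)
    (hμ : ∀ (n : ℕ) (a : ZMod (p ^ n)),
      ∑ b ∈ Finset.univ.filter (fun b : ZMod (p ^ (n + 1)) ↦
        ZMod.castHom (pow_dvd_pow p n.le_succ) (ZMod (p ^ n)) b = a), μ (n + 1) b = μ n a)
    (n : ℕ) (a : ZMod (p ^ n)) :
    ∑ b ∈ Finset.univ.filter (fun b : ZMod (p ^ (n + 1)) ↦
        ZMod.castHom (pow_dvd_pow p n.le_succ) (ZMod (p ^ n)) b = a), codilate c μ (n + 1) b =
      codilate c μ n a := by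
  set u : (ZMod (p ^ (n + 1)))ˣ := ZMod.unitOfCoprime c (coprime_pow_of_coprime hc (n + 1)) with hu
  have huval : (u : ZMod (p ^ (n + 1))) = (c : ZMod (p ^ (n + 1))) := rfl
  have hred : ZMod.castHom (pow_dvd_pow p n.le_succ) (ZMod (p ^ n)) (u : ZMod (p ^ (n + 1))) =
      (c : ZMod (p ^ n)) := by
    rw [huval, map_natCast]
  simp only [codilate]
  rw [← hred, ← huval]
  exact sum_fiber_mul_unit_of_distribution hμ n a u

/-- **`[c]_*(μ ⋆ ν) = μ ⋆ [c]_*ν`** (no hypothesis on `c`: `(a c⁻¹) x⁻¹ = (a x⁻¹) c⁻¹`).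
[cite: LangCyclotomic1990, Ch. 12 §1 (PDF p. 187)] -/
theorem unitsConv_dilate_right (c : ℕ) : unitsConv μ (dilate c ν) = dilate c (unitsConv μ ν) := by
  funext n a
  simp only [unitsConv, dilate]
  exact Finset.sum_congr rfl fun x _ ↦ by rw [mul_right_comm]

/-- **`[c]^*(μ ⋆ ν) = μ ⋆ [c]^*ν`.** [cite: LangCyclotomic1990, Ch. 12 §1 (PDF p. 187)] -/
theorem unitsConv_codilate_right (c : ℕ) :
    unitsConv μ (codilate c ν) = codilate c (unitsConv μ ν) := by
  funext n a
  simp only [unitsConv, codilate]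
  exact Finset.sum_congr rfl fun x _ ↦ by rw [mul_right_comm]

/-- **`([c]_*μ) ⋆ ν = [c]_*(μ ⋆ ν)`** for `c` prime to `p` (substitute `x ↦ x·c` in the sum over
units). [cite: LangCyclotomic1990, Ch. 12 §1 (PDF p. 187)] -/
theorem unitsConv_dilate_left {c : ℕ} (hc : p.Coprime c) :
    unitsConv (dilate c μ) ν = dilate c (unitsConv μ ν) := by
  funext n a
  simp only [unitsConv, dilate]
  set u : (ZMod (p ^ n))ˣ := ZMod.unitOfCoprime c (coprime_pow_of_coprime hc n) with hu
  have huval : (u : ZMod (p ^ n)) = (c : ZMod (p ^ n)) := rfl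
  have huinv : ((u⁻¹ : (ZMod (p ^ n))ˣ) : ZMod (p ^ n)) = (c : ZMod (p ^ n))⁻¹ := rfl
  -- substitute `x ↦ x u⁻¹` in the sum over the unit group
  refine Fintype.sum_equiv (Equiv.mulRight u⁻¹) _ _ fun x ↦ ?_
  simp only [Equiv.coe_mulRight, mul_inv_rev, inv_inv, Units.val_mul, huinv, huval]
  have hkey : a * (c : ZMod (p ^ n))⁻¹ * ((c : ZMod (p ^ n)) * ((x⁻¹ : (ZMod (p ^ n))ˣ) : ZMod (p ^ n))) =
      a * ((x⁻¹ : (ZMod (p ^ n))ˣ) : ZMod (p ^ n)) := by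
    rw [← mul_assoc, mul_assoc a, mul_comm ((c : ZMod (p ^ n))⁻¹), natCast_mul_inv_eq_one hc,
      mul_one]
  rw [hkey]

end Algebra

/-! ### `[c]^*` on the left; inversion exchanges `[c]_*` and `[c]^*` -/

section AlgebraInv

variable {μ μ₁ μ₂ ν : (n : ℕ) → ZMod (p ^ n) → ℚ_[p]}

/-- **`([c]^*μ) ⋆ ν = [c]^*(μ ⋆ ν)`** for `c` prime to `p` (substitute `x ↦ x·c⁻¹`).
[cite: LangCyclotomic1990, Ch. 12 §1 (PDF p. 187)] -/
theorem unitsConv_codilate_left {c : ℕ} (hc : p.Coprime c) :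
    unitsConv (codilate c μ) ν = codilate c (unitsConv μ ν) := by
  have h := unitsConv_dilate_left (μ := codilate c μ) (ν := ν) hc
  rw [dilate_codilate hc] at h
  rw [h, codilate_dilate hc]

/-- `μ̌` is additive in `μ`. [cite: LangCyclotomic1990, Ch. 4 §2 (PDF pp. 80–82)] -/
theorem invUnitsDist_add : invUnitsDist (μ₁ + μ₂) = invUnitsDist μ₁ + invUnitsDist μ₂ := by
  funext n a
  simp only [invUnitsDist, Pi.add_apply]
  split_ifs <;> simp

/-- `μ̌` commutes with subtraction. [cite: LangCyclotomic1990, Ch. 4 §2 (PDF pp. 80–82)] -/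
theorem invUnitsDist_sub : invUnitsDist (μ₁ - μ₂) = invUnitsDist μ₁ - invUnitsDist μ₂ := by
  funext n a
  simp only [invUnitsDist, Pi.sub_apply]
  split_ifs <;> simp

/-- `μ̌` is homogeneous. [cite: LangCyclotomic1990, Ch. 4 §2 (PDF pp. 80–82)] -/
theorem invUnitsDist_smul (r : ℚ_[p]) : invUnitsDist (r • μ) = r • invUnitsDist μ := by
  funext n a
  simp only [invUnitsDist, Pi.smul_apply, smul_eq_mul]
  split_ifs <;> simp

/-- **Inversion turns `[c]_*` into `[c]^*`**: `([c]_*μ)ˇ = [c]^*(μ̌)` for `c` prime to `p`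
(`(a c)⁻¹ = a⁻¹c⁻¹`; this is why Stevens' second smoothing factor carries `σ(r₂)⁻¹`).
[cite: Stevens1982, §5.4 (PDF p. 73, Sm_{r₁}^{r₂} = (1 − r₁σ(r₁))(1 − r₂σ(r₂)⁻¹))] [cite: LangCyclotomic1990, Ch. 4 §2 (PDF pp. 80–82)] -/
theorem invUnitsDist_dilate {c : ℕ} (hc : p.Coprime c) :
    invUnitsDist (dilate c μ) = codilate c (invUnitsDist μ) := by
  funext n a
  by_cases ha : IsUnit a
  · have hu : IsUnit (c : ZMod (p ^ n)) := by
      rw [← ZMod.coe_unitOfCoprime c (coprime_pow_of_coprime hc n)]; exact Units.isUnit _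
    have hac : IsUnit (a * (c : ZMod (p ^ n))) := ha.mul hu
    rw [codilate, invUnitsDist, dif_pos ha, invUnitsDist, dif_pos hac, dilate]
    congr 1
    have h1 : (hac.unit : ZMod (p ^ n)) = (ha.unit : ZMod (p ^ n)) * (hu.unit : ZMod (p ^ n)) := by
      rw [IsUnit.unit_spec, IsUnit.unit_spec, IsUnit.unit_spec]
    have h2 : hac.unit = ha.unit * hu.unit := Units.ext (by rw [Units.val_mul]; exact h1)
    rw [h2, mul_inv_rev, Units.val_mul, ← ZMod.inv_coe_unit hu.unit, IsUnit.unit_spec, mul_comm]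
  · have hac : ¬ IsUnit (a * (c : ZMod (p ^ n))) := fun h ↦ ha ((isUnit_mul_natCast_iff hc a).mp h)
    rw [codilate, invUnitsDist, dif_neg ha, invUnitsDist, dif_neg hac]

/-- **Inversion turns `[c]^*` into `[c]_*`**: `([c]^*μ)ˇ = [c]_*(μ̌)` for `c` prime to `p`.
[cite: Stevens1982, §5.4 (PDF p. 73)] [cite: LangCyclotomic1990, Ch. 4 §2 (PDF pp. 80–82)] -/
theorem invUnitsDist_codilate {c : ℕ} (hc : p.Coprime c) :
    invUnitsDist (codilate c μ) = dilate c (invUnitsDist μ) := by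
  have h := invUnitsDist_dilate (μ := codilate c μ) hc
  rw [dilate_codilate hc] at h
  rw [h, dilate_codilate hc]

end AlgebraInv

/-! ### The transforms of `[c]_*μ` and `[c]^*μ`: multiplication by `(1+T)^{±ℓ(c)}` -/

section DilateTransform

variable {μ : (n : ℕ) → ZMod (p ^ n) → ℚ_[p]}

/-- With `c ≡ η_c γ^{f} ` at every level (`exists_teichmuller_exponent_natCast`), the inverse of
`c` modulo `p^{n+e₀}` is the class `η_c⁻¹ γ^{−f}`. [folklore] -/
private theorem inv_natCast_eq_classMap {c : ℕ} {ηc : rootsOfUnity (torsionOrder p) ℤ_[p]} {f : ℤ_[p]}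
    (hcf : ∀ n : ℕ, PadicInt.toZModPow (n + cyclotomicExponent p) ((ηc : ℤ_[p]ˣ) : ℤ_[p]) *
        (cyclotomicGenerator p : ZMod (p ^ (n + cyclotomicExponent p))) ^ (PadicInt.toZModPow n f).val =
        (c : ZMod (p ^ (n + cyclotomicExponent p)))) (n : ℕ) :
    ((c : ZMod (p ^ (n + cyclotomicExponent p))))⁻¹ =
      PadicInt.toZModPow (n + cyclotomicExponent p) (((ηc⁻¹ : rootsOfUnity (torsionOrder p) ℤ_[p]) :
          ℤ_[p]ˣ) : ℤ_[p]) *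
        (cyclotomicGenerator p : ZMod (p ^ (n + cyclotomicExponent p))) ^
          (PadicInt.toZModPow n (-f)).val := by
  refine ZMod.inv_eq_of_mul_eq_one _ _ _ ?_
  rw [← hcf n, ← classMap_mul p n ηc ηc⁻¹ (PadicInt.toZModPow n f) (PadicInt.toZModPow n (-f)),
    mul_inv_cancel, map_neg, add_neg_cancel]
  exact classMap_one p n

/-- **The transform of the push-forward `[c]_*μ` is `(1+T)^{ℓ(c)} · L_μ`** (Lang Ch. 4 §2, Meas 1 /
Example 1: the Dirac mass at `c` has power series `(1+X)^{ℓ(c)}`, and convolution with it is `[c]_*`;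
Matsuno 2000 Lemma 3.3 "`t(ℓx) = t(ℓ) + t(x)`" — tree `tendsto_riemannSum_translate`): for a bounded
distribution `μ` and `c` with Teichmüller–exponent data `c ≡ η_c γ^{f}` at all levels
(`exists_teichmuller_exponent_natCast`), `L_{[c]_*μ}(T) = (1+T)^{f} · L_μ(T)`
(`(1+T)^f = PowerSeries.binomialSeries ℚ_p f`).
[cite: LangCyclotomic1990, Ch. 4 §2, Meas 1 and §1 Example 1 (PDF pp. 79–81)] [cite: MazurTateTeitelbaum1986Invent, §I.13] -/
theorem distributionTransform_dilate {c : ℕ} {ηc : rootsOfUnity (torsionOrder p) ℤ_[p]} {f : ℤ_[p]}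
    (hcf : ∀ n : ℕ, PadicInt.toZModPow (n + cyclotomicExponent p) ((ηc : ℤ_[p]ˣ) : ℤ_[p]) *
        (cyclotomicGenerator p : ZMod (p ^ (n + cyclotomicExponent p))) ^ (PadicInt.toZModPow n f).val =
        (c : ZMod (p ^ (n + cyclotomicExponent p))))
    (hμ : ∀ (n : ℕ) (a : ZMod (p ^ n)),
      ∑ b ∈ Finset.univ.filter (fun b : ZMod (p ^ (n + 1)) ↦
        ZMod.castHom (pow_dvd_pow p n.le_succ) (ZMod (p ^ n)) b = a), μ (n + 1) b = μ n a)
    {C : ℝ} (hC : ∀ (n : ℕ) (a : ZMod (p ^ n)), ‖μ n a‖ ≤ C) :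
    distributionTransform (dilate c μ) =
      PowerSeries.binomialSeries ℚ_[p] f * distributionTransform μ := by
  -- the Riemann sums of `[c]_*μ` are those of `μ` translated by the class `c⁻¹ = η_c⁻¹γ^{−f}`
  have hRSz : ∀ k n : ℕ, distributionRiemannSum (dilate c μ) k n =
      ∑ᶠ η : rootsOfUnity (torsionOrder p) ℤ_[p], ∑ s : ZMod (p ^ n),
        μ (n + cyclotomicExponent p)
            ((PadicInt.toZModPow (n + cyclotomicExponent p)
                  (((ηc⁻¹ : rootsOfUnity (torsionOrder p) ℤ_[p]) : ℤ_[p]ˣ) : ℤ_[p]) *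
                (cyclotomicGenerator p : ZMod (p ^ (n + cyclotomicExponent p))) ^
                  (PadicInt.toZModPow n (-f)).val) *
              (PadicInt.toZModPow (n + cyclotomicExponent p) ((η : ℤ_[p]ˣ) : ℤ_[p]) *
                (cyclotomicGenerator p : ZMod (p ^ (n + cyclotomicExponent p))) ^ s.val)) *
          ((s.val.choose k : ℕ) : ℚ_[p]) := by
    intro k n
    rw [distributionRiemannSum]
    refine finsum_congr fun η ↦ Finset.sum_congr rfl fun s _ ↦ ?_
    rw [dilate, inv_natCast_eq_classMap hcf n, mul_comm (PadicInt.toZModPow _ ((η : ℤ_[p]ˣ) : ℤ_[p]) * _)]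
  ext k
  have h := coeff_C_mul_binomialSeries_mul (1 : ℚ_[p]) f (distributionTransform μ) k
  rw [map_one, one_mul, one_mul] at h
  rw [h, coeff_distributionTransform]
  simp only [coeff_distributionTransform]
  refine Tendsto.limUnder_eq ?_
  have ht := tendsto_riemannSum_translate hμ hC (distributionRiemannSum_spec μ) hRSz k
  simpa only [neg_neg] using ht

/-- **The transform of the pull-back `[c]^*μ` is `(1+T)^{−ℓ(c)} · L_μ`.**
[cite: LangCyclotomic1990, Ch. 4 §2, Meas 1 and §1 Example 1 (PDF pp. 79–81)] [cite: MazurTateTeitelbaum1986Invent, §I.13] -/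
theorem distributionTransform_codilate {c : ℕ} {ηc : rootsOfUnity (torsionOrder p) ℤ_[p]} {f : ℤ_[p]}
    (hcf : ∀ n : ℕ, PadicInt.toZModPow (n + cyclotomicExponent p) ((ηc : ℤ_[p]ˣ) : ℤ_[p]) *
        (cyclotomicGenerator p : ZMod (p ^ (n + cyclotomicExponent p))) ^ (PadicInt.toZModPow n f).val =
        (c : ZMod (p ^ (n + cyclotomicExponent p))))
    (hμ : ∀ (n : ℕ) (a : ZMod (p ^ n)),
      ∑ b ∈ Finset.univ.filter (fun b : ZMod (p ^ (n + 1)) ↦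
        ZMod.castHom (pow_dvd_pow p n.le_succ) (ZMod (p ^ n)) b = a), μ (n + 1) b = μ n a)
    {C : ℝ} (hC : ∀ (n : ℕ) (a : ZMod (p ^ n)), ‖μ n a‖ ≤ C) :
    distributionTransform (codilate c μ) =
      PowerSeries.binomialSeries ℚ_[p] (-f) * distributionTransform μ := by
  have hRSz : ∀ k n : ℕ, distributionRiemannSum (codilate c μ) k n =
      ∑ᶠ η : rootsOfUnity (torsionOrder p) ℤ_[p], ∑ s : ZMod (p ^ n),
        μ (n + cyclotomicExponent p)
            ((PadicInt.toZModPow (n + cyclotomicExponent p) ((ηc : ℤ_[p]ˣ) : ℤ_[p]) *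
                (cyclotomicGenerator p : ZMod (p ^ (n + cyclotomicExponent p))) ^
                  (PadicInt.toZModPow n f).val) *
              (PadicInt.toZModPow (n + cyclotomicExponent p) ((η : ℤ_[p]ˣ) : ℤ_[p]) *
                (cyclotomicGenerator p : ZMod (p ^ (n + cyclotomicExponent p))) ^ s.val)) *
          ((s.val.choose k : ℕ) : ℚ_[p]) := by
    intro k n
    rw [distributionRiemannSum]
    refine finsum_congr fun η ↦ Finset.sum_congr rfl fun s _ ↦ ?_
    rw [codilate, ← hcf n, mul_comm (PadicInt.toZModPow _ ((η : ℤ_[p]ˣ) : ℤ_[p]) * _)]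
  ext k
  have h := coeff_C_mul_binomialSeries_mul (1 : ℚ_[p]) (-f) (distributionTransform μ) k
  rw [map_one, one_mul, one_mul] at h
  rw [h, coeff_distributionTransform]
  simp only [coeff_distributionTransform]
  refine Tendsto.limUnder_eq ?_
  exact tendsto_riemannSum_translate hμ hC (distributionRiemannSum_spec μ) hRSz k

/-- **Existence form** (with `exists_teichmuller_exponent_natCast`): for `c` prime to `p` there is
`f ∈ ℤ_p` (`⟨c⟩ = γ^f`, i.e. `f = ℓ(c)`) with `L_{[c]_*μ} = (1+T)^{f}·L_μ` and
`L_{[c]^*μ} = (1+T)^{−f}·L_μ` for every bounded distribution `μ`.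
[cite: LangCyclotomic1990, Ch. 4 §2, Meas 1 (PDF p. 81) and §3 (⟨a⟩, PDF p. 84)] [cite: MazurTateTeitelbaum1986Invent, §I.13] -/
theorem exists_exponent_distributionTransform_dilate {c : ℕ} (hc : ¬ p ∣ c) :
    ∃ f : ℤ_[p], ∀ (μ : (n : ℕ) → ZMod (p ^ n) → ℚ_[p]),
      (∀ (n : ℕ) (a : ZMod (p ^ n)),
        ∑ b ∈ Finset.univ.filter (fun b : ZMod (p ^ (n + 1)) ↦
          ZMod.castHom (pow_dvd_pow p n.le_succ) (ZMod (p ^ n)) b = a), μ (n + 1) b = μ n a) →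
      (∃ C : ℝ, ∀ (n : ℕ) (a : ZMod (p ^ n)), ‖μ n a‖ ≤ C) →
        distributionTransform (dilate c μ) =
            PowerSeries.binomialSeries ℚ_[p] f * distributionTransform μ ∧
          distributionTransform (codilate c μ) =
            PowerSeries.binomialSeries ℚ_[p] (-f) * distributionTransform μ := by
  obtain ⟨ηc, f, hcf⟩ := exists_teichmuller_exponent_natCast (p := p) hc
  exact ⟨f, fun μ hμ ⟨C, hC⟩ ↦
    ⟨distributionTransform_dilate hcf hμ hC, distributionTransform_codilate hcf hμ hC⟩⟩

end DilateTransform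

/-! ## §6 The unregularised `θ`-twisted Bernoulli distribution `θE_k` and Lang's regularisation
`θE_{k,c} = (1 − c^kθ(c)·[c]_*)(θE_k)`; at `p = 2`: `klTwoConv = Sm_5^5((χ₋₄E₁)ˇ ⋆ χ₋₄E₁)` -/

section Bernoulli

variable (p)

/-- **The `θ`-twisted (unregularised) Bernoulli distribution `θ·E_k` of level `N` on `ℤ_p`**:
`(θE_k)(a + pⁿℤ_p) = ∑_{b ∈ ℤ/Npⁿ, b ≡ a (pⁿ)} θ(b)·E_k^{(Npⁿ)}(b)`, `E_k^{(M)}(b) = M^{k−1}B_k(⟨b/M⟩)/k`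
(Lang Ch. 2 §2: `E_k` is a distribution — with unbounded values, not a measure; Stevens §5.2:
`λ_B`, "not a measure").  Same shape as the tree's `bernoulliMeasure` with `regBernoulliDist`
replaced by `bernoulliDist`. [cite: LangCyclotomic1990, Ch. 2 §2 (E_k^{(N)}, B 4; PDF p. 34)] [cite: Stevens1982, §5.2 (PDF p. 68, λ_B)] -/
def bernoulliDistribution (N : ℕ) [NeZero N] (θ : ℕ → ℤ_[p]) (k : ℕ) (n : ℕ) (a : ZMod (p ^ n)) :
    ℚ_[p] :=
  ∑ b ∈ Finset.univ.filter (fun b : ZMod (N * p ^ n) ↦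
      ZMod.castHom (Dvd.intro_left N rfl) (ZMod (p ^ n)) b = a),
    ((θ b.val : ℤ_[p]) : ℚ_[p]) * (((bernoulliDist k (N * p ^ n) b / k : ℚ)) : ℚ_[p])

variable {p}
variable {N : ℕ} [NeZero N] {θ : ℕ → ℤ_[p]} {k : ℕ}

omit [Fact p.Prime] in
/-- Regrouping a sum over `ℤ/dℤ` along `ℤ/dℤ → ℤ/bℤ → ℤ/aℤ`. [folklore] -/
private theorem sum_fiber_fiber' {a b d : ℕ} [NeZero b] [NeZero d] (hab : a ∣ b) (hbd : b ∣ d)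
    {R : Type*} [AddCommMonoid R] (F : ZMod d → R) (x : ZMod a) :
    ∑ y ∈ Finset.univ.filter (fun y : ZMod b ↦ ZMod.castHom hab (ZMod a) y = x),
        ∑ z ∈ Finset.univ.filter (fun z : ZMod d ↦ ZMod.castHom hbd (ZMod b) z = y), F z =
      ∑ z ∈ Finset.univ.filter (fun z : ZMod d ↦ ZMod.castHom (hab.trans hbd) (ZMod a) z = x),
        F z := by
  rw [← Finset.sum_fiberwise_of_maps_to
    (s := Finset.univ.filter (fun z : ZMod d ↦ ZMod.castHom (hab.trans hbd) (ZMod a) z = x))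
    (t := Finset.univ.filter (fun y : ZMod b ↦ ZMod.castHom hab (ZMod a) y = x))
    (g := ZMod.castHom hbd (ZMod b))]
  · refine Finset.sum_congr rfl fun y hy ↦ Finset.sum_congr ?_ fun _ _ ↦ rfl
    ext z
    simp only [Finset.mem_filter, Finset.mem_univ, true_and]
    constructor
    · intro hz
      refine ⟨?_, hz⟩
      rw [← (Finset.mem_filter.mp hy).2, ← hz, castHom_castHom_zmod]
    · exact fun h ↦ h.2
  · intro z hz
    simp only [Finset.mem_filter, Finset.mem_univ, true_and] at hz ⊢
    rw [castHom_castHom_zmod]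
    exact hz

omit [NeZero N] in
/-- An `N`-periodic `θ` is `mN`-periodic. [folklore] -/
private theorem periodic_mul (hθ : ∀ b, θ (b + N) = θ b) (b m : ℕ) : θ (b + m * N) = θ b := by
  induction m with
  | zero => rw [zero_mul, add_zero]
  | succ m ih => rw [Nat.succ_mul, ← add_assoc, hθ, ih]

/-- **`θE_k` satisfies the distribution relation on the `p`-power tower** (Lang Ch. 2 §2, **B 4**:
`E_k` is a distribution; `θ` has period `N`; `k ≥ 1`).
[cite: LangCyclotomic1990, Ch. 2 §2, B 4 and E_k (PDF p. 34)] -/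
theorem bernoulliDistribution_distribution (hθ : ∀ b, θ (b + N) = θ b) (hk : 1 ≤ k) (n : ℕ)
    (a : ZMod (p ^ n)) :
    ∑ b ∈ Finset.univ.filter (fun b : ZMod (p ^ (n + 1)) ↦
        ZMod.castHom (pow_dvd_pow p n.le_succ) (ZMod (p ^ n)) b = a),
      bernoulliDistribution p N θ k (n + 1) b = bernoulliDistribution p N θ k n a := by
  have hNN : N * p ^ n ∣ N * p ^ (n + 1) := mul_dvd_mul_left N (pow_dvd_pow p n.le_succ)
  have hθ' : ∀ b j : ℕ, θ (b + j * (N * p ^ n)) = θ b := by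
    intro b j
    rw [show b + j * (N * p ^ n) = b + (j * p ^ n) * N by ring, periodic_mul hθ]
  unfold bernoulliDistribution
  rw [sum_fiber_fiber' (pow_dvd_pow p n.le_succ) (Dvd.intro_left N rfl)]
  rw [show (pow_dvd_pow p n.le_succ).trans (Dvd.intro_left N rfl) =
      (Dvd.intro_left N rfl : p ^ n ∣ N * p ^ n).trans hNN from rfl,
    ← sum_fiber_fiber' (Dvd.intro_left N rfl) hNN]
  refine Finset.sum_congr rfl fun b₀ _ ↦ ?_
  have hθfib : ∀ b ∈ Finset.univ.filter (fun b : ZMod (N * p ^ (n + 1)) ↦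
      ZMod.castHom hNN (ZMod (N * p ^ n)) b = b₀), θ b.val = θ b₀.val := by
    intro b hb
    have hb' := (Finset.mem_filter.mp hb).2
    have hval : b.val % (N * p ^ n) = b₀.val := by
      have h := congr_arg ZMod.val hb'
      rwa [ZMod.castHom_apply, ZMod.cast_eq_val, ZMod.val_natCast] at h
    rw [← Nat.mod_add_div' b.val (N * p ^ n), hval, hθ']
  rw [Finset.sum_congr rfl fun b hb ↦ by rw [hθfib b hb], ← Finset.mul_sum]
  congr 1
  have h := sum_fiber_bernoulliDist hNN hk b₀
  have h' : (((bernoulliDist k (N * p ^ n) b₀ / k : ℚ)) : ℚ_[p]) =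
      (((∑ b ∈ Finset.univ.filter (fun b : ZMod (N * p ^ (n + 1)) ↦
        ZMod.castHom hNN (ZMod (N * p ^ n)) b = b₀), bernoulliDist k (N * p ^ (n + 1)) b) / k :
        ℚ) : ℚ_[p]) := by rw [h]
  rw [h', Finset.sum_div]
  push_cast
  rfl

/-- Translating the fibre of `ℤ/Npⁿ → ℤ/pⁿ` over `a` by a unit `u` gives the fibre over `a·ū`.
[folklore] -/
private theorem sum_fiber_level_mul_unit (n : ℕ) {R : Type*} [AddCommMonoid R]
    (F : ZMod (N * p ^ n) → R) (a : ZMod (p ^ n)) (u : (ZMod (N * p ^ n))ˣ) :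
    ∑ b ∈ Finset.univ.filter (fun b : ZMod (N * p ^ n) ↦
        ZMod.castHom (Dvd.intro_left N rfl) (ZMod (p ^ n)) b = a), F (b * (u : ZMod (N * p ^ n))) =
      ∑ b ∈ Finset.univ.filter (fun b : ZMod (N * p ^ n) ↦
        ZMod.castHom (Dvd.intro_left N rfl) (ZMod (p ^ n)) b =
          a * ZMod.castHom (Dvd.intro_left N rfl) (ZMod (p ^ n)) (u : ZMod (N * p ^ n))), F b := by
  have hyinv : ZMod.castHom (Dvd.intro_left N rfl) (ZMod (p ^ n)) (u : ZMod (N * p ^ n)) *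
      ZMod.castHom (Dvd.intro_left N rfl) (ZMod (p ^ n)) ((u⁻¹ : (ZMod (N * p ^ n))ˣ) : ZMod _) = 1 := by
    rw [← map_mul, Units.mul_inv, map_one]
  refine Finset.sum_nbij' (fun b ↦ b * (u : ZMod (N * p ^ n)))
    (fun c ↦ c * ((u⁻¹ : (ZMod (N * p ^ n))ˣ) : ZMod (N * p ^ n))) (fun b hb ↦ ?_) (fun c hc ↦ ?_)
    (fun b _ ↦ ?_) (fun c _ ↦ ?_) (fun b _ ↦ rfl)
  · simp only [Finset.mem_filter, Finset.mem_univ, true_and] at hb ⊢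
    rw [map_mul, hb]
  · simp only [Finset.mem_filter, Finset.mem_univ, true_and] at hc ⊢
    rw [map_mul, hc, mul_assoc, hyinv, mul_one]
  · rw [mul_assoc, Units.mul_inv, mul_one]
  · rw [mul_assoc, Units.inv_mul, mul_one]

/-- **Lang's regularisation as a smoothing: `θE_{k,c} = θE_k − c^kθ(c)·[c]_*(θE_k)`** — the tree's
`bernoulliMeasure p N c θ k` is `(1 − c^kθ(c)[c]_*)` applied to `bernoulliDistribution p N θ k`, for a
multiplicative `N`-periodic `θ` and `c` prime to `Np` (`E_{k,c} = E_k − c^k E_k∘c⁻¹`, and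
`θ(b) = θ(c)θ(bc⁻¹)`). This is Stevens' `Sm_c λ_B = (1 − cσ(c))λ_B` for `θ = 1`, `k = 1`.
[cite: LangCyclotomic1990, Ch. 2 §2, E_{k,c} = E_k − c^k E_k∘c⁻¹ (PDF p. 35)] [cite: Stevens1982, §5.2 (PDF pp. 68–69, Sm_r λ_B)] -/
theorem bernoulliMeasure_eq_sub_dilate {c : ℕ} (hc : c.Coprime (N * p)) (hθ : ∀ b, θ (b + N) = θ b)
    (hθmul : ∀ a b, θ (a * b) = θ a * θ b) :
    bernoulliMeasure p N c θ k =
      bernoulliDistribution p N θ k -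
        (((c : ℚ_[p]) ^ k * ((θ c : ℤ_[p]) : ℚ_[p])) • dilate c (bernoulliDistribution p N θ k)) := by
  funext n a
  have hcn : c.Coprime (N * p ^ n) :=
    Nat.Coprime.mul_right (Nat.Coprime.coprime_mul_right_right hc)
      (Nat.Coprime.pow_right _ (Nat.Coprime.coprime_mul_left_right hc))
  have hcp : p.Coprime c := (Nat.Coprime.coprime_mul_left_right hc).symm
  set u : (ZMod (N * p ^ n))ˣ := ZMod.unitOfCoprime c hcn with hu
  have huval : (u : ZMod (N * p ^ n)) = (c : ZMod (N * p ^ n)) := rfl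
  have huinv : ((u⁻¹ : (ZMod (N * p ^ n))ˣ) : ZMod (N * p ^ n)) = (c : ZMod (N * p ^ n))⁻¹ := rfl
  have hred : ZMod.castHom (Dvd.intro_left N rfl) (ZMod (p ^ n))
      ((u⁻¹ : (ZMod (N * p ^ n))ˣ) : ZMod (N * p ^ n)) = (c : ZMod (p ^ n))⁻¹ := by
    refine (ZMod.inv_eq_of_mul_eq_one _ _ _ ?_).symm
    rw [huinv, ← map_natCast (ZMod.castHom (Dvd.intro_left N rfl) (ZMod (p ^ n))) c, ← map_mul,
      ZMod.coe_mul_inv_eq_one c hcn, map_one]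
  -- `θ((b' c).val) = θ(b'.val) θ(c)` (periodicity and multiplicativity)
  have hθc : ∀ b' : ZMod (N * p ^ n), θ (b' * (c : ZMod (N * p ^ n))).val = θ b'.val * θ c := by
    intro b'
    rw [ZMod.val_mul, ZMod.val_natCast, Nat.mul_mod_mod, ← hθmul]
    conv_rhs => rw [← Nat.mod_add_div (b'.val * c) (N * p ^ n)]
    rw [show b'.val * c % (N * p ^ n) + N * p ^ n * (b'.val * c / (N * p ^ n)) =
      b'.val * c % (N * p ^ n) + (p ^ n * (b'.val * c / (N * p ^ n))) * N by ring, periodic_mul hθ]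
  simp only [Pi.sub_apply, Pi.smul_apply, smul_eq_mul, bernoulliMeasure, bernoulliDistribution,
    dilate, regBernoulliDist]
  push_cast
  simp only [mul_sub, Finset.sum_sub_distrib, sub_div]
  congr 1
  -- the regularising term: substitute `b = b' c`
  rw [← hred, ← sum_fiber_level_mul_unit n _ a u⁻¹, Finset.mul_sum]
  refine Finset.sum_congr rfl fun b _ ↦ ?_
  have hbc : b * ((u⁻¹ : (ZMod (N * p ^ n))ˣ) : ZMod (N * p ^ n)) * (c : ZMod (N * p ^ n)) = b := by
    rw [huinv, mul_assoc, mul_comm ((c : ZMod (N * p ^ n))⁻¹), ZMod.coe_mul_inv_eq_one c hcn, mul_one]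
  have hθb : θ b.val = θ (b * ((u⁻¹ : (ZMod (N * p ^ n))ˣ) : ZMod (N * p ^ n))).val * θ c := by
    rw [← hθc, hbc]
  rw [hθb, huinv]
  push_cast
  ring

end Bernoulli

/-! ### At `p = 2`: `χ₋₄E₁`, its Dedekind convolution, and `klTwoConv = Sm_5^5` of it -/

section DedekindTwo

/-- **The unregularised measure-to-be `χ₋₄E₁` on `ℤ₂`** (level `4`, `k = 1`): for `n ≥ 2` its value on
`a + 2ⁿℤ₂` is `χ₋₄(a)·B₁(⟨a/2ⁿ⟩) = χ₋₄(a)·((a/2ⁿ))` (`klTwoDistribution_eq_of_two_le`) — the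
`χ₋₄`-twisted sawtooth, Stevens' `λ_B` at `p = 2` twisted by `ω = χ₋₄`; unbounded (denominators `2ⁿ`).
[cite: LangCyclotomic1990, Ch. 2 §2 (E_1, PDF p. 34) and Ch. 4 §3 (χE_{1,c}, PDF p. 84)] [cite: Stevens1982, §5.2 (PDF p. 68, λ_B)] -/
def klTwoDistribution : (n : ℕ) → ZMod (2 ^ n) → ℚ_[2] :=
  bernoulliDistribution 2 4 (chiMinusFour 2) 1

/-- **The `χ₋₄`-weighted Dedekind convolution `(χ₋₄E₁)ˇ ⋆ (χ₋₄E₁)` on `ℤ₂^×`**: for `n ≥ 2` and odd `h`,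
its value on `h + 2ⁿℤ₂` is `χ₋₄(h)·∑_{x odd mod 2ⁿ} ((x/2ⁿ))((hx/2ⁿ)) = χ₋₄(h)·(s(h,2ⁿ) − s(h,2ⁿ⁻¹))`
(Dedekind sums; `klTwoDedekindConv_eq_of_two_le`) — Stevens' (unsmoothed) Eisenstein/Dedekind-symbol
distribution shape at `p = 2`; a distribution, not a measure.
[cite: Stevens1982, §2.5 and §5.4 (PDF p. 73, μ_E "is not a measure")] [cite: LangCyclotomic1990, Ch. 12 §1 (PDF p. 187)] -/
def klTwoDedekindConv : (n : ℕ) → ZMod (2 ^ n) → ℚ_[2] :=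
  unitsConv (invUnitsDist klTwoDistribution) klTwoDistribution

/-- `5` is prime to `4·2`. [cite: LangCyclotomic1990, Ch. 4 §3 (c prime to Np, PDF p. 84)] -/
private theorem coprime_five_four_two : (5 : ℕ).Coprime (4 * 2) := by norm_num

/-- `2` is prime to `5`. [folklore] -/
private theorem coprime_two_five : (2 : ℕ).Coprime 5 := by norm_num

/-- **`χ₋₄E_{1,5} = (1 − 5·[5]_*)(χ₋₄E₁)`** at `p = 2` (`χ₋₄(5) = 1`): the tree's `klTwoMeasure` is the
`Sm_5`-smoothing of `klTwoDistribution`. [cite: LangCyclotomic1990, Ch. 2 §2 (E_{1,c} = E_1 − cE_1∘c⁻¹, PDF p. 35)] [cite: Stevens1982, §5.2 (PDF pp. 68–69, Sm_r λ_B)] -/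
theorem klTwoMeasure_eq_sub_dilate :
    klTwoMeasure = klTwoDistribution - (5 : ℚ_[2]) • dilate 5 klTwoDistribution := by
  have h := bernoulliMeasure_eq_sub_dilate (p := 2) (N := 4) (θ := chiMinusFour 2) (k := 1)
    coprime_five_four_two (chiMinusFour_add_four 2) (chiMinusFour_mul 2)
  have h5 : chiMinusFour 2 5 = 1 := by rw [chiMinusFour_eq_ite]; norm_num
  rw [h5] at h
  simpa [klTwoMeasure, klTwoDistribution] using h

/-- **`(χ₋₄E_{1,5})ˇ = (1 − 5·[5]^*)((χ₋₄E₁)ˇ)`** (inversion exchanges `[5]_*` and `[5]^*`).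
[cite: Stevens1982, §5.4 (PDF p. 73, the factor (1 − r₂σ(r₂)⁻¹))] [cite: LangCyclotomic1990, Ch. 4 §2 (PDF pp. 80–82)] -/
theorem klTwoMeasureInv_eq_sub_codilate :
    klTwoMeasureInv = invUnitsDist klTwoDistribution -
      (5 : ℚ_[2]) • codilate 5 (invUnitsDist klTwoDistribution) := by
  rw [klTwoMeasureInv, klTwoMeasure_eq_sub_dilate, invUnitsDist_sub, invUnitsDist_smul,
    invUnitsDist_dilate coprime_two_five]

/-- **`klTwoConv = Sm_5^5((χ₋₄E₁)ˇ ⋆ χ₋₄E₁)`**: the tree's smoothed Dedekind–Eisenstein measure at `2`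
is `D − 5·[5]_*D − 5·[5]^*D + 25·D` for the `χ₋₄`-weighted Dedekind convolution `D = klTwoDedekindConv`
— Stevens' `Sm_{r₁}^{r₂} = (1 − r₁σ(r₁))(1 − r₂σ(r₂)⁻¹)` with `r₁ = r₂ = 5`, verbatim (bilinearity of `⋆`,
`[c]_*`, `[c]^*` commute with `⋆`, `[5]^*[5]_* = 1`).
[cite: Stevens1982, §5.4 (PDF p. 73, Sm_{r₁}^{r₂}(μ_E) and Prop. 5.4.1)] [cite: LangCyclotomic1990, Ch. 12 §1 (PDF p. 187)] -/
theorem klTwoConv_eq_smoothing :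
    klTwoConv = klTwoDedekindConv - (5 : ℚ_[2]) • dilate 5 klTwoDedekindConv -
      (5 : ℚ_[2]) • codilate 5 klTwoDedekindConv + (25 : ℚ_[2]) • klTwoDedekindConv := by
  rw [klTwoConv, klTwoMeasureInv_eq_sub_codilate, klTwoMeasure_eq_sub_dilate, unitsConv_sub_left,
    unitsConv_sub_right, unitsConv_sub_right, unitsConv_smul_right, unitsConv_smul_left,
    unitsConv_smul_left, unitsConv_smul_right, unitsConv_dilate_right,
    unitsConv_codilate_left coprime_two_five, unitsConv_codilate_left coprime_two_five,
    unitsConv_dilate_right, codilate_dilate coprime_two_five, ← klTwoDedekindConv, smul_smul]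
  norm_num
  abel

/-- For `n ≥ 2` the level-`n` value of `χ₋₄E₁` is `χ₋₄(a)·E_1^{(2ⁿ)}(a) = χ₋₄(a)·(a/2ⁿ − ½)` (the four
lifts of `a` to `ℤ/4·2ⁿ` have the same `χ₋₄`, and `E_1` is a distribution).
[cite: LangCyclotomic1990, Ch. 2 §2, B 4 (PDF p. 34) and Ch. 4 §3 (PDF p. 84)] -/
theorem klTwoDistribution_eq_of_two_le {n : ℕ} (hn : 2 ≤ n) (a : ZMod (2 ^ n)) :
    klTwoDistribution n a = ((chiMinusFour 2 a.val : ℤ_[2]) : ℚ_[2]) *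
      ((bernoulliDist 1 (2 ^ n) a : ℚ) : ℚ_[2]) := by
  haveI : NeZero (2 ^ n) := ⟨pow_ne_zero _ two_ne_zero⟩
  have h4 : 4 ∣ 2 ^ n := by
    obtain ⟨m, rfl⟩ := Nat.exists_eq_add_of_le hn
    exact ⟨2 ^ m, by ring⟩
  -- `χ₋₄` is constant on the fibre of `a`
  have hθfib : ∀ b ∈ Finset.univ.filter (fun b : ZMod (4 * 2 ^ n) ↦
      ZMod.castHom (Dvd.intro_left 4 rfl) (ZMod (2 ^ n)) b = a), chiMinusFour 2 b.val = chiMinusFour 2 a.val := by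
    intro b hb
    have hb' := (Finset.mem_filter.mp hb).2
    have hval : b.val % 2 ^ n = a.val := by
      have h := congr_arg ZMod.val hb'
      rwa [ZMod.castHom_apply, ZMod.cast_eq_val, ZMod.val_natCast] at h
    obtain ⟨q, hq⟩ := h4
    have hper : ∀ x m : ℕ, chiMinusFour 2 (x + m * 4) = chiMinusFour 2 x := by
      intro x m
      induction m with
      | zero => rw [zero_mul, add_zero]
      | succ m ih => rw [Nat.succ_mul, ← add_assoc, chiMinusFour_add_four, ih]
    have key : ∀ t : ℕ, chiMinusFour 2 (a.val + 2 ^ n * t) = chiMinusFour 2 a.val := fun t ↦ by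
      rw [show 2 ^ n * t = (q * t) * 4 by rw [hq]; ring]
      exact hper _ _
    rw [← Nat.mod_add_div b.val (2 ^ n), hval]
    exact key _
  rw [klTwoDistribution, bernoulliDistribution,
    Finset.sum_congr rfl fun b hb ↦ by rw [hθfib b hb], ← Finset.mul_sum]
  congr 1
  rw [← sum_fiber_bernoulliDist (Dvd.intro_left 4 rfl) le_rfl a]
  push_cast
  simp only [div_one]

/-- `χ₋₄` read on representatives modulo `m`, `4 ∣ m`, is Mathlib's `χ₄` composed with reduction.
[cite: LangCyclotomic1990, Ch. 4 §3 (χ extended by 0, PDF p. 84) (unfolding of Mathlib's `ZMod.χ₄`)] -/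
theorem chiMinusFour_val_eq_χ₄_castHom {m : ℕ} [NeZero m] (h4 : 4 ∣ m) (y : ZMod m) :
    chiMinusFour 2 y.val = ((ZMod.χ₄ (ZMod.castHom h4 (ZMod 4) y) : ℤ) : ℤ_[2]) := by
  unfold chiMinusFour
  rw [ZMod.castHom_apply, ZMod.cast_eq_val]

/-- `χ₄(u²) = 1` for a unit `u` of `ℤ/4`. [folklore] -/
private theorem χ₄_mul_self_of_unit (u : (ZMod 4)ˣ) : ZMod.χ₄ ((u : ZMod 4) * (u : ZMod 4)) = 1 := by
  revert u
  decide

/-- **The Dedekind convolution in Dedekind-sum shape**: for `n ≥ 2` and a unit `h` modulo `2ⁿ`,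
`((χ₋₄E₁)ˇ ⋆ χ₋₄E₁)(h + 2ⁿℤ₂) = χ₋₄(h) · ∑_{x ∈ (ℤ/2ⁿ)^×} E_1^{(2ⁿ)}(x⁻¹)·E_1^{(2ⁿ)}(h x⁻¹)`
`= χ₋₄(h)·∑_{x odd} ((x/2ⁿ))((hx/2ⁿ))` (substituting `x ↦ x⁻¹`; `χ₋₄(x⁻¹)χ₋₄(hx⁻¹) = χ₋₄(h)`), i.e.
`χ₋₄(h)·(s(h,2ⁿ) − s(h,2ⁿ⁻¹))` with the Dedekind sum `s(h,k) = ∑_{i mod k}((i/k))((hi/k))` (the even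
`i` contribute `s(h,2ⁿ⁻¹)`). Stated in the tree's `bernoulliDist` (no Dedekind-sum definition is
introduced here). [cite: Stevens1982, §2.5 (Dedekind symbol) and §5.4 (PDF pp. 72–73)] -/
theorem klTwoDedekindConv_eq_of_two_le {n : ℕ} (hn : 2 ≤ n) (h : (ZMod (2 ^ n))ˣ) :
    klTwoDedekindConv n (h : ZMod (2 ^ n)) =
      ((chiMinusFour 2 (h : ZMod (2 ^ n)).val : ℤ_[2]) : ℚ_[2]) *
        ∑ x : (ZMod (2 ^ n))ˣ, ((bernoulliDist 1 (2 ^ n) ((x⁻¹ : (ZMod (2 ^ n))ˣ) : ZMod (2 ^ n)) : ℚ) : ℚ_[2]) *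
          ((bernoulliDist 1 (2 ^ n) ((h : ZMod (2 ^ n)) * ((x⁻¹ : (ZMod (2 ^ n))ˣ) : ZMod (2 ^ n))) : ℚ) :
            ℚ_[2]) := by
  haveI : NeZero (2 ^ n) := ⟨pow_ne_zero _ two_ne_zero⟩
  have h4 : 4 ∣ 2 ^ n := by
    obtain ⟨m, rfl⟩ := Nat.exists_eq_add_of_le hn
    exact ⟨2 ^ m, by ring⟩
  rw [klTwoDedekindConv, unitsConv, Finset.mul_sum]
  refine Finset.sum_congr rfl fun x _ ↦ ?_
  rw [invUnitsDist, dif_pos (Units.isUnit x), IsUnit.unit_of_val_units,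
    klTwoDistribution_eq_of_two_le hn, klTwoDistribution_eq_of_two_le hn]
  -- `χ₋₄(x⁻¹)·χ₋₄(h x⁻¹) = χ₋₄(h)`
  have hχ : chiMinusFour 2 ((x⁻¹ : (ZMod (2 ^ n))ˣ) : ZMod (2 ^ n)).val *
      chiMinusFour 2 ((h : ZMod (2 ^ n)) * ((x⁻¹ : (ZMod (2 ^ n))ˣ) : ZMod (2 ^ n))).val =
      chiMinusFour 2 (h : ZMod (2 ^ n)).val := by
    simp only [chiMinusFour_val_eq_χ₄_castHom h4, map_mul]
    have hu := χ₄_mul_self_of_unit (Units.map (ZMod.castHom h4 (ZMod 4)).toMonoidHom x⁻¹)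
    rw [Units.coe_map, RingHom.toMonoidHom_eq_coe, MonoidHom.coe_coe] at hu
    rw [← Int.cast_mul, mul_left_comm, ← map_mul ZMod.χ₄, hu, mul_one]
  have hχ' : ((chiMinusFour 2 ((x⁻¹ : (ZMod (2 ^ n))ˣ) : ZMod (2 ^ n)).val : ℤ_[2]) : ℚ_[2]) *
      ((chiMinusFour 2 ((h : ZMod (2 ^ n)) * ((x⁻¹ : (ZMod (2 ^ n))ˣ) : ZMod (2 ^ n))).val : ℤ_[2]) :
        ℚ_[2]) = ((chiMinusFour 2 (h : ZMod (2 ^ n)).val : ℤ_[2]) : ℚ_[2]) := by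
    rw [← PadicInt.coe_mul, hχ]
  rw [← hχ']
  ring

end DedekindTwo

/-! ## §7 The bridge to Dedekind sums (tree `Literature.NumberTheory.ModularForms.dedekindSum`):
`s(h, p^{n+1}) = ∑_{x ∈ (ℤ/p^{n+1})^×} ((x/p^{n+1}))((hx/p^{n+1})) + s(h, pⁿ)`, and at `p = 2`
`((χ₋₄E₁)ˇ ⋆ χ₋₄E₁)(h + 2ⁿℤ₂) = χ₋₄(h)·(s(h,2ⁿ) − s(h,2ⁿ⁻¹))` -/

section DedekindSum

open Literature.NumberTheory.ModularForms

omit [Fact p.Prime] in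
/-- Summing `G(b.val)` over `ℤ/M` is summing `G` over `0 ≤ μ < M`. [folklore] -/
private theorem sum_univ_val_eq_sum_range {M : ℕ} [NeZero M] {R : Type*} [AddCommMonoid R]
    (G : ℕ → R) : ∑ b : ZMod M, G b.val = ∑ μ ∈ Finset.range M, G μ := by
  refine Finset.sum_nbij' (fun b ↦ b.val) (fun μ ↦ (μ : ZMod M)) (fun b _ ↦ ?_) (fun μ hμ ↦ ?_)
    (fun b _ ↦ ?_) (fun μ hμ ↦ ?_) (fun b _ ↦ rfl)
  · exact Finset.mem_range.mpr (ZMod.val_lt b)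
  · exact Finset.mem_univ _
  · exact ZMod.natCast_zmod_val b
  · exact ZMod.val_natCast_of_lt (Finset.mem_range.mp hμ)

/-- **The unit part of a Dedekind sum at a prime-power modulus**: for every prime `p`, `h ∈ ℤ`, `n`,
`s(h, p^{n+1}) = ∑_{x ∈ (ℤ/p^{n+1})^×} ((x/p^{n+1}))·((hx/p^{n+1})) + s(h, pⁿ)` — the terms `μ = pν`
of `s(h,p^{n+1}) = ∑_{μ mod p^{n+1}} ((μ/p^{n+1}))((hμ/p^{n+1}))` are the terms of `s(h, pⁿ)`.  (This is
the `α = 1` stabilisation `Φ(h/p^{n+1}) − Φ(h/pⁿ)` of the Dedekind-sum distribution as a sum over the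
UNIT classes — the shape of `unitsConv`.)
[cite: RademacherGrosswald1972, Ch. 1 eq. (1)–(2)] [cite: Stevens1982, §2.5 and §5.4 (PDF pp. 72–73)] -/
theorem dedekindSum_pow_succ_eq_sum_units_add (h : ℤ) (n : ℕ) :
    dedekindSum h (p ^ (n + 1)) =
      ∑ x : (ZMod (p ^ (n + 1)))ˣ,
          dedekindSaw (((x : ZMod (p ^ (n + 1))).val : ℚ) / (p ^ (n + 1) : ℕ)) *
            dedekindSaw ((h : ℚ) * ((x : ZMod (p ^ (n + 1))).val : ℚ) / (p ^ (n + 1) : ℕ)) +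
        dedekindSum h (p ^ n) := by
  have hp : p.Prime := Fact.out
  haveI : NeZero (p ^ (n + 1)) := ⟨pow_ne_zero _ hp.ne_zero⟩
  haveI : NeZero (p ^ n) := ⟨pow_ne_zero _ hp.ne_zero⟩
  set F : ℕ → ℚ := fun μ ↦ dedekindSaw ((μ : ℚ) / (p ^ (n + 1) : ℕ)) *
    dedekindSaw ((h : ℚ) * (μ : ℚ) / (p ^ (n + 1) : ℕ)) with hF
  have hLHS : dedekindSum h (p ^ (n + 1)) = ∑ b : ZMod (p ^ (n + 1)), F b.val := by
    rw [dedekindSum, sum_univ_val_eq_sum_range F]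
  have hmem : ∀ b : ZMod (p ^ (n + 1)), ¬ IsUnit b ↔ p ∣ b.val := by
    intro b
    conv_lhs => rw [← ZMod.natCast_zmod_val b]
    rw [ZMod.isUnit_natCast_iff_not_dvd_pow hp (Nat.succ_pos n), not_not]
  have hmul_lt : ∀ ν : ℕ, ν < p ^ n → p * ν < p ^ (n + 1) := fun ν hν ↦
    (Nat.mul_lt_mul_of_pos_left hν hp.pos).trans_eq (pow_succ' p n).symm
  -- the unit classes
  have hunits : ∑ b ∈ Finset.univ.filter (fun b : ZMod (p ^ (n + 1)) ↦ IsUnit b), F b.val =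
      ∑ x : (ZMod (p ^ (n + 1)))ˣ, F (x : ZMod (p ^ (n + 1))).val :=
    (sum_units_eq_sum_filter_isUnit (F := fun b : ZMod (p ^ (n + 1)) ↦ F b.val)).symm
  -- the non-unit classes `b = p ν`, `ν < pⁿ`
  have hnonunits : ∑ b ∈ Finset.univ.filter (fun b : ZMod (p ^ (n + 1)) ↦ ¬ IsUnit b), F b.val =
      dedekindSum h (p ^ n) := by
    rw [dedekindSum]
    symm
    refine Finset.sum_nbij' (fun ν ↦ ((p * ν : ℕ) : ZMod (p ^ (n + 1)))) (fun b ↦ b.val / p)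
      (fun ν hν ↦ ?_) (fun b hb ↦ ?_) (fun ν hν ↦ ?_) (fun b hb ↦ ?_) (fun ν hν ↦ ?_)
    · simp only [Finset.mem_filter, Finset.mem_univ, true_and]
      rw [hmem, ZMod.val_natCast_of_lt (hmul_lt ν (Finset.mem_range.mp hν))]
      exact dvd_mul_right p ν
    · simp only [Finset.mem_filter, Finset.mem_univ, true_and] at hb
      rw [Finset.mem_range]
      have hlt : b.val < p * p ^ n := (ZMod.val_lt b).trans_eq (pow_succ' p n)
      exact Nat.div_lt_of_lt_mul hlt
    · rw [ZMod.val_natCast_of_lt (hmul_lt ν (Finset.mem_range.mp hν)), Nat.mul_div_cancel_left ν hp.pos]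
    · simp only [Finset.mem_filter, Finset.mem_univ, true_and] at hb
      rw [Nat.mul_div_cancel' ((hmem b).mp hb), ZMod.natCast_zmod_val]
    · -- the summands agree: `((pν/p^{n+1})) = ((ν/pⁿ))`
      have hν' := Finset.mem_range.mp hν
      have hval : (((p * ν : ℕ) : ZMod (p ^ (n + 1)))).val = p * ν :=
        ZMod.val_natCast_of_lt (hmul_lt ν hν')
      have hp0 : (p : ℚ) ≠ 0 := by exact_mod_cast hp.ne_zero
      rw [hval]
      simp only [hF, Nat.cast_pow, Nat.cast_mul, pow_succ']
      congr 1
      · congr 1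
        field_simp
      · congr 1
        field_simp
  rw [hLHS, ← Finset.sum_filter_add_sum_filter_not Finset.univ (fun b : ZMod (p ^ (n + 1)) ↦ IsUnit b),
    hunits, hnonunits]

/-- `E_1^{(M)}(b) = b/M − ½ = ((b/M))` for `b ≢ 0 (mod M)` (`B_1(X) = X − ½`; `0 < b/M < 1`).
[cite: LangCyclotomic1990, Ch. 2 §2, B 2 (B_1 = X − ½; PDF p. 39)] [cite: RademacherGrosswald1972, Ch. 1 eq. (2)] -/
theorem bernoulliDist_one_eq_dedekindSaw {M : ℕ} [NeZero M] {b : ZMod M} (hb : b ≠ 0) :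
    bernoulliDist 1 M b = dedekindSaw ((b.val : ℚ) / M) := by
  have hM : (0 : ℚ) < M := by exact_mod_cast Nat.pos_of_ne_zero (NeZero.ne M)
  have h0 : (0 : ℚ) < (b.val : ℚ) / M :=
    div_pos (by exact_mod_cast (ZMod.val_pos.mpr hb)) hM
  have h1 : (b.val : ℚ) / M < 1 := by
    rw [div_lt_one hM]; exact_mod_cast ZMod.val_lt b
  rw [dedekindSaw_of_pos_of_lt_one h0 h1, bernoulliDist, Polynomial.bernoulli_one]
  simp only [Nat.sub_self, pow_zero, one_mul, Polynomial.eval_sub, Polynomial.eval_X, Polynomial.eval_C]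
  norm_num

/-- **`((χ₋₄E₁)ˇ ⋆ χ₋₄E₁)(h + 2ⁿℤ₂) = χ₋₄(h)·(s(h, 2ⁿ) − s(h, 2ⁿ⁻¹))`** for `n ≥ 2` and odd `h`:
the `χ₋₄`-weighted Dedekind convolution of this file is, at each unit class, `χ₋₄(h)` times the
`α = 1`-stabilised Dedekind sum (tree `Literature.NumberTheory.ModularForms.dedekindSum`) — the
Eisenstein side of the mod-2 identity studied Summit-side, now entirely in tree vocabulary:
`klTwoConv = Sm_5^5` of THIS (`klTwoConv_eq_smoothing`) and `L(klTwoConv) = G(T^ι)G(T)`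
(`distributionTransform_klTwoConv`).
[cite: Stevens1982, §2.5 (Dedekind symbol = Dedekind sums) and §5.4 (PDF pp. 72–73)] [cite: RademacherGrosswald1972, Ch. 1 eq. (1)] -/
theorem klTwoDedekindConv_eq_dedekindSum {n : ℕ} (hn : 2 ≤ n) (h : (ZMod (2 ^ n))ˣ) :
    klTwoDedekindConv n (h : ZMod (2 ^ n)) =
      ((chiMinusFour 2 (h : ZMod (2 ^ n)).val : ℤ_[2]) : ℚ_[2]) *
        (((dedekindSum ((h : ZMod (2 ^ n)).val : ℤ) (2 ^ n) -
            dedekindSum ((h : ZMod (2 ^ n)).val : ℤ) (2 ^ (n - 1)) : ℚ)) : ℚ_[2]) := by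
  haveI : NeZero (2 ^ n) := ⟨pow_ne_zero _ two_ne_zero⟩
  haveI : Fact (1 < 2 ^ n) := ⟨Nat.one_lt_two_pow (by omega)⟩
  obtain ⟨m, rfl⟩ : ∃ m, n = m + 1 := ⟨n - 1, by omega⟩
  rw [klTwoDedekindConv_eq_of_two_le hn, Nat.add_sub_cancel,
    dedekindSum_pow_succ_eq_sum_units_add (p := 2), add_sub_cancel_right]
  congr 1
  push_cast
  -- reindex `x ↦ x⁻¹` and identify the summands
  refine Fintype.sum_equiv (Equiv.inv (ZMod (2 ^ (m + 1)))ˣ) _ _ fun x ↦ ?_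
  simp only [Equiv.inv_apply]
  have hx : ((x⁻¹ : (ZMod (2 ^ (m + 1)))ˣ) : ZMod (2 ^ (m + 1))) ≠ 0 := Units.ne_zero _
  have hhx : (h : ZMod (2 ^ (m + 1))) * ((x⁻¹ : (ZMod (2 ^ (m + 1)))ˣ) : ZMod (2 ^ (m + 1))) ≠ 0 := by
    rw [← Units.val_mul]; exact Units.ne_zero _
  rw [bernoulliDist_one_eq_dedekindSaw hx, bernoulliDist_one_eq_dedekindSaw hhx]
  -- `((h·x)).val/2^{m+1}` and `h.val·x.val/2^{m+1}` differ by an integer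
  have hper : dedekindSaw ((((h : ZMod (2 ^ (m + 1))) *
      ((x⁻¹ : (ZMod (2 ^ (m + 1)))ˣ) : ZMod (2 ^ (m + 1)))).val : ℚ) / (2 ^ (m + 1) : ℕ)) =
      dedekindSaw ((((h : ZMod (2 ^ (m + 1))).val : ℤ) : ℚ) *
        (((x⁻¹ : (ZMod (2 ^ (m + 1)))ˣ) : ZMod (2 ^ (m + 1))).val : ℚ) / (2 ^ (m + 1) : ℕ)) := by
    rw [ZMod.val_mul]
    set a := (h : ZMod (2 ^ (m + 1))).val with ha
    set b := ((x⁻¹ : (ZMod (2 ^ (m + 1)))ˣ) : ZMod (2 ^ (m + 1))).val with hb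
    have hM : ((2 ^ (m + 1) : ℕ) : ℚ) ≠ 0 := by positivity
    have hdec : ((a : ℤ) : ℚ) * (b : ℚ) / (2 ^ (m + 1) : ℕ) =
        ((a * b % 2 ^ (m + 1) : ℕ) : ℚ) / (2 ^ (m + 1) : ℕ) + ((a * b / 2 ^ (m + 1) : ℕ) : ℤ) := by
      have h2 : a * b = a * b % 2 ^ (m + 1) + a * b / 2 ^ (m + 1) * 2 ^ (m + 1) := by
        have h := Nat.mod_add_div (a * b) (2 ^ (m + 1))
        rw [mul_comm (2 ^ (m + 1))] at h
        exact h.symm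
      rw [Int.cast_natCast, Int.cast_natCast, div_add' _ _ _ hM, div_left_inj' hM]
      exact_mod_cast h2
    rw [hdec, dedekindSaw_add_intCast]
  push_cast at hper ⊢
  rw [hper]

end DedekindSum

end Literature.NumberTheory.EllipticCurves

end
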